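import Literature.Computability.AlgebraicComplexity.IP17KroneckerPositivity
import Literature.Computability.AlgebraicComplexity.IP17StretchedHookComputationsA
import Literature.Computability.AlgebraicComplexity.IP17StretchedHookComputationsB1d
import Literature.Computability.AlgebraicComplexity.IP17StretchedHookComputationsB2d
import Literature.Computability.AlgebraicComplexity.IP17StretchedHookComputationsB3d
import Literature.Computability.AlgebraicComplexity.IP17StretchedHookComputationsB4d
import Literature.Computability.Complexity.OccurrenceObstructionsIPComputations
import Literature.Computability.Complexity.OccurrenceObstructionsIPStability
import Literature.Barriers.ValiantsHypothesis.GCTMatrixPoweringColumns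
import Literature.Barriers.ValiantsHypothesis.GCTMatrixPoweringProp17OnlyIf
import HarnessLib

/-!
# Ikenmeyer–Panova 2017, Prop. 5.2, Cor. 5.3, Cor. 5.4, Cor. 6.3 — PROVED (discharge of four named
# facts); Cor. 5.1 reduced to Prop. 6.4, Cor. 6.10 reduced to Prop. 6.9

Sibling proofs file (D-0014; theorems only, no definitions, no new named facts) of
`Literature/Computability/AlgebraicComplexity/IP17KroneckerPositivity.lean`, which typed §5–§7 of
C. Ikenmeyer, G. Panova, *Rectangular Kronecker coefficients and plethysms in geometric complexity
theory*, Adv. Math. 319 (2017) 40–66 = arXiv:1512.03798v2 [key `IkenmeyerPanova2017`] as named facts.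
Here four of them are discharged, by the PRINTED proofs:

* `ikenmeyerPanova2017_prop_5_2_holds : ikenmeyerPanova2017_prop_5_2` — **Prop. 5.2** (TeX label
  `prop:stretchedhooks`, L1231; held text `paper:arxiv-1512.03798`: Proposition 25, chunk p0013):
  "Let `i > 1`. For any `m ≥ 7` and `k ∈ [0, m² - 1]` we have that
  `g(i(m² - k, 1^k), m × (im), m × (mi)) > 0`."
* `ikenmeyerPanova2017_cor_5_3_holds : ikenmeyerPanova2017_cor_5_3` — **Cor. 5.3** (stretching
  factor 2; TeX L1273; held: Corollary 26).
* `ikenmeyerPanova2017_cor_5_4_holds : ikenmeyerPanova2017_cor_5_4` — **Cor. 5.4** (trivial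
  saturation of the rectangular Kronecker semigroup; TeX L1298; held: Corollary 27).

* `ikenmeyerPanova2017_cor_6_3_holds : ikenmeyerPanova2017_cor_6_3` — **Cor. 6.3** (bodies with
  prescribed column multiplicities against `d × n`, `d > 6`; TeX L1363; held: Corollary 30).

and a fifth is REDUCED: `ikenmeyerPanova2017_cor_5_1_of_prop_6_4 : ikenmeyerPanova2017_prop_6_4 →
ikenmeyerPanova2017_cor_5_1` — **Cor. 5.1** (`a_ρ = 0 ⇔ ρ ∈ 𝔛`; TeX L1219; held: Corollary 24): the
direction `⇒` (`ρ ∉ 𝔛 ⇒ a_ρ > 0`) is PROVED unconditionally (`kroneckerCoeff_pos_of_body_not_mem`, from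
the tree's `ikenmeyerPanova2017_thm_1_7b_holds` = printed Thm. 1.10, and Manivel's stability); of the
direction `⇐` ("a small finite calculation"), the bodies `(2,1)`, `(3,1)` are certified in the kernel
(`𝔖_9`, `𝔖_16`, after reduction to one coefficient each by the stability) and the hooks
`(1), (1,1), (1⁴), (1⁶)` are Thm. 6.1, i.e. Prop. 6.4 — the coefficient for `(1⁶)` lives in `𝔖_36`,
beyond the kernel, which is why Prop. 6.4 (named fact) remains a hypothesis. A sixth is REDUCED
likewise: `ikenmeyerPanova2017_cor_6_10_of_prop_6_9 : ikenmeyerPanova2017_prop_6_9 →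
ikenmeyerPanova2017_cor_6_10` — **Cor. 6.10** (two columns against `n × d`, `n ≠ d`; TeX L1487; held:
Corollary 34) by its printed one-line proof ("By transposing the two row partition and one of the
rectangles, the statement follows directly from Prop. 6.9"), the column `k = 0` and the empty frame
being settled directly (`g((1^N), R, R) = [Rᵗ = R]`, tree `kroneckerCoeff_column_eq`). After this file
the named facts of `IP17KroneckerPositivity.lean` that remain hypotheses anywhere are exactly Prop. 6.4,
Prop. 6.8, Prop. 6.9 and Claim 7.1.

VP ≠ VNP is NOT proved and nothing here bears on it: these are positivity statements about Kronecker
coefficients of the symmetric groups (`g = kroneckerCoeff ℂ`, `SymmetricGroupReps.lean`).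

## The printed proof of Prop. 5.2 and how it is followed (TeX L1234–1261)

1. "the proposition follows from the hook positivity as long as `k ≠ 1, 2, 4, 6, m²-7, m²-5, m²-3,
   m²-2`": the hook `(m²-k, 1^k)` is positive against `m × m` (the tree's PROVED IP Cor. 4.5 /
   Thm. 6.1, `ikenmeyerPanova2017_cor_4_4_square`), and `i` copies are added with the semigroup
   property (`ikenmeyerPanova2017_semigroup_holds`): `stretchedHook_pos_add`, `stretchedHook_pos_of_one`.
2. "For `i ≥ 4` … `i = 2i₁ + 3i₂` … we can always assume that `i ≤ 3`": `stretchedHook_pos_of_two_three`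
   (`i = (i - 2) + 2`).
3. "In the case when `k = 1, 2, 4, 6` finite calculations for `i = 2, 3` and `m = 7` give positive
   values" — these are Kronecker coefficients of `𝔖_98` and `𝔖_147`, beyond kernel certification.
   **Deviation (same move, smaller input):** the body `(i^k)` is already positive against a SMALLER
   frame `c × d` (`c ≤ m`, `d ≤ im`), from which the frame grows to `m × im` by the one-row triples
   (the tree's `kroneckerCoeff_pos_of_frame_le` / `pos_rows_of_kronSum`, IP's own constant move of §4);
   the eight small coefficients are ALREADY certified in the tree among the base cases of IP Thm. 4.6
   (`ipcComp_2_2_1` `(2,2)/2×2`, `ipcComp_2_3_1` `(2,2,2)/2×3`, `ipcComp_3_4_9` `(4,2⁴)/3×4`,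
   `ipcComp_3_5_11` `(3,2⁶)/3×5`, `ipcComp_3_3_1` `(6,3)/3×3`, `ipcComp_3_3_6` `(3³)/3×3`,
   `ipcComp_3_5_8` `(3⁵)/3×5`, `ipcComp_4_6_1` `(6,3⁶)/4×6`): `stretchedHook_pos_of_kronSum`,
   `stretchedHook_pos_two_one` … `stretchedHook_pos_three_six`.
4. The four large legs, `r := m² - k - 1 ∈ {1, 2, 4, 6}`: "Let `μ^i[a,b] := ((ab-r)^i, 1^{ir})` …
   `μ^i[m,m] = (i(m-k, 1^k))ᵗ`, so by transposing one of the rectangles the statement to prove is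
   equivalent to showing that `g(μ^i[m,m], (im) × m, m × (im)) > 0`. … Claim: for all `a, b` …
   `g(μ^i[a,b], (ia) × b, a × (bi)) > 0`. We prove this claim by induction on `(a,b)`, with initial
   condition computationally verified for `(a,b) = (7,7)` … Consider `(a,b) = (a₀, b₀+1)`. Since
   `g((ia₀), (a₀^i), (a₀^i)) > 0` after transposing the first two partitions … `g(a₀^i, 1^{ia₀}, i^{a₀}) > 0`.
   Add this triple … By the symmetry between `a` and `b` …": `stretchedHook_claim_step` (the added
   triple is the tree's `kroneckerCoeff_indiscrete_transpose_pos`), `stretchedHook_claim_symm`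
   (`kroneckerCoeff_transpose`), `stretchedHook_claim_of_base`, and the reduction
   `stretchedHook_pos_of_claim` (`kroneckerCoeff_transpose₁₂`; the rows of the transposed shape are
   its column lengths). **Deviation (smaller base):** the printed base `(7,7)` is again in `𝔖_98`,
   `𝔖_147`; the induction is started instead at `(2,2)` (`i = 2`, `r = 1, 2`: `𝔖_8`) and `(3,3)`
   (`i = 2`, `r = 4, 6`: `𝔖_18`; `i = 3`, all four `r`: `𝔖_27` — the triples at `(2,2)`, `(2,3)`,
   `(2,4)` vanish for `i = 3`, so `(3,3)` is the smallest possible base), certified in the kernel with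
   the verified Murnaghan–Nakayama evaluator (`MNEval.kronSum`, `kroneckerCoeff_pos_iff_kronSum_pos`) in
   the sibling files `IP17StretchedHookComputationsA.lean` (`𝔖_8`, `𝔖_18`) and
   `IP17StretchedHookComputationsB{1,2,3,4}{a,b,c,d}.lean` (`𝔖_27`: `g = 1, 1, 6, 1` for
   `r = 1, 2, 4, 6`, each class sum split into 51 kernel evaluations): `stretchedHook_claim_base_*`.

Cor. 5.3 (TeX L1277–1281: "Cut `ρ` columnwise and group pairs of columns of the same length `k` so
that you get partitions `(k × 2)`. By Prop. 5.2 we have `a_{(k×2)}(m) > 0`. Using the semigroup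
property we get the result."): `evenBody_pos_aux` peels the column pairs (the rows `min(ρ_t, 2)` form
the block `(c × 2)`, `c` = number of rows) and adds the blocks of Prop. 5.2 with the semigroup property
in the orientation `m × n`; the frame is transposed (`kroneckerCoeff_rectangle_transpose`) and the given
`n ≥ |ρ|` is reached by Manivel's stability, IP Thm. 2.1 — in the tree the EQUALITY
`kroneckerCoeff_rowLift_eq` and the monotonicity `kroneckerCoeff_le_kroneckerCoeff_rowLift` — which is
what makes the printed `a_ρ(m)` a well-defined number (`pos_of_rows_eq_of_bodySize_le`).

Cor. 5.4 (TeX L1301–1310: "`(k × 3)(3m²) ∈ S_d` and `(k × 2)(2m²) ∈ S_d`. Subtracting these we obtain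
`(m²-k, k × 1) ∈ G_d` … `v_{k+1} := (-1,0,…,0,1,0,…,0) ∈ G_d` … `ν := ∑ λ_k v_k` … Since
`(d,0,…,0) ∈ S_d` we have `λ ∈ G_d`"): `saturation_aux` does this bookkeeping column by column — the
row-vector identity `col_c + 2(d²-(c-1), 1^{c-1}) + (d² - c)·e₁ = 3(d²-(c-1), 1^{c-1})` — collecting
the multiples of `e₁` in a number `C`, which by counting boxes is a multiple `d q₃` of `d` and is
realised by the one-row triple `((d q₃), d × q₃, d × q₃)` (`kroneckerCoeff_pos_rowAdd_row_holds`); the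
two members `μ, ν ∈ S_d` with `λ + ν = μ` are produced explicitly, as the fact demands.

Cor. 6.3 (TeX L1367–1374: "Since `ρ = ∑ᵢ (i^{m_i})`, the statement follows by the Kronecker semigroup
property", the blocks being positive by Prop. 5.2 / Thm. 6.1): as typed — `m_i` = number of columns of
`ρ` of length `i` = multiplicity of `i` in `ρᵗ` (`count_transpose_parts_eq`: `m_i = ρ_i - ρ_{i+1}`) —
the block of the `m_i` columns of length `i` is the body of the stretched hook with stretching factor
`m_i` and leg `i`: positive against `d × m_i d` by Prop. 5.2 when `m_i ≥ 2` (any `i ≤ d² - 1`), and the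
hook with leg `i` against `d × d` (Thm. 6.1 = tree `ikenmeyerPanova2017_cor_4_4`) when `m_i = 1`, which
is where the printed conditions `m_i ≠ 1` (`i ∈ {1,2,4,6}`), `m_i = 0` (`i ∈ {d²-7,…,d²-2}`) enter;
`fatHook_pos_aux` peels the blocks from the longest columns down and adds them with the semigroup
property, and `n ≥ n₀` is reached by one-row triples (`kroneckerCoeff_pos_rowAdd_row_holds`). The printed
proof's auxiliary `6 × 6` computation (three columns of length `1, 2, 4, 6`) is not needed once Prop. 5.2
covers every stretching factor `≥ 2`; nothing weaker or stronger than the typed statement is proved.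

Cor. 6.10 (TeX L1490–1491): `twoColumn_rows`, `ikenmeyerPanova2017_cor_6_10_of_prop_6_9` (transposition
`kroneckerCoeff_transpose₁₂`, the `S₃`-symmetry `kroneckerCoeff_comm₁₂/₂₃_holds`, the rows of `λᵗ` as
column lengths; the divisibility `(n - d) ∣ n ⇔ (d - n) ∣ d`).

Cor. 5.1 (TeX L1222–1224: "Given `ρ ∉ 𝔛`, `a_ρ > 0` can be seen by choosing large `d` and `n` and
applying Thm. 1.10. For `ρ ∈ 𝔛`, `a_ρ = 0` is a small finite calculation."): `kroneckerCoeff_eq_of_frame_le`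
(the value `a_ρ` does not depend on the frame `n × d`, `n, d ≥ |ρ|`: `kroneckerCoeff_rowLift_eq` in both
directions, frames transposed), `kroneckerCoeff_pos_of_body_not_mem`, `kronSum_body21_square_three`,
`kronSum_body31_square_four`, `hook_kroneckerCoeff_eq_zero_of_prop_6_4`, `ikenmeyerPanova2017_cor_5_1_of_prop_6_4`.

## References

* C. Ikenmeyer, G. Panova, Adv. Math. 319 (2017) 40–66 = arXiv:1512.03798v2: Prop. 5.2 with proof
  (TeX `pub-gct/inputs/files/src/1512.03798/main.tex` L1231–1262; held `paper:arxiv-1512.03798`: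
  Proposition 25, chunk p0013), Cor. 5.3 with proof (TeX L1273–1281; held: Corollary 26, chunk p0014),
  Cor. 5.4 with proof (TeX L1287–1310; held: Corollary 27, chunk p0014); Cor. 5.1 with proof (TeX L1219–1225;
  held: Corollary 24, chunk p0013); Cor. 6.3 with proof (TeX L1363–1374; held: Corollary 30, chunk p0015);
  Cor. 6.10 with proof (TeX L1486–1491; held: Corollary 34, chunk p0017); Prop. 6.9 (TeX L1467–1484);
  Thm. 1.10 (held: Thm. 7); Thm. 6.1 (TeX L1340–1353); Thm. 2.1 / Rem. 2.2
  (stability, `a_ρ(d)`; TeX L500–520); §1.1 (semigroup and transposition properties).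
  [key `IkenmeyerPanova2017`]
* L. Manivel, *On rectangular Kronecker coefficients*, J. Algebraic Combin. 33 (2011) 153–162, Thm. 1
  (the stability used for `a_ρ(d)`). [key `Manivel2011`]
* W. Fulton, *Young Tableaux*, LMS Student Texts 35 (1997), §0 (conjugate partition; column
  multiplicities `m_i = λ_i - λ_{i+1}`). [key `FultonYoungTableaux1997`]

## Mathlib and tree

Mathlib: `Nat.Partition`, `Multiset.sort_cons`, `List.getElem?_replicate`, `Finset.sum_range_add`,
`Nat.find`, `Nat.le_induction`, `Nat.strong_induction_on`. Tree (all PROVED there):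
`ikenmeyerPanova2017_semigroup_holds`, `kroneckerCoeff_transpose`, `kroneckerCoeff_transpose₁₂`,
`kroneckerCoeff_indiscrete_pos`, `kroneckerCoeff_indiscrete_transpose_pos`,
`kroneckerCoeff_rectangle_transpose`, `kroneckerCoeff_pos_rowAdd_row_holds`, `kroneckerCoeff_rowLift_eq`,
`kroneckerCoeff_le_kroneckerCoeff_rowLift`, `ikenmeyerPanova2017_cor_4_4_square`, `pos_rows_of_kronSum`,
`ipcComp_*` (`OccurrenceObstructionsIP*.lean`), `partitionOfRows`, `getD_sortedParts_*`,
`parts_eq_of_getD_sortedParts_eq`, `body_eq_coe_tail` (shapes by rows), `colCount`,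
`getD_sortedParts_eq_colCount_transpose` (`Barriers/ValiantsHypothesis/GCTMatrixPoweringColumns.lean`),
`kroneckerCoeff_column_eq`, `kroneckerCoeff_indiscrete_eq` (`…/GCTMatrixPoweringProp17OnlyIf.lean`), `MNEval.kronSum`,
`kroneckerCoeff_pos_iff_kronSum_pos` (`SymmetricGroupCharacterEvaluation.lean`), and the kernel
certificates `ipsh_kronSum_*` of `IP17StretchedHookComputations*.lean`.
-/

noncomputable section

open scoped BigOperators

namespace Literature.Computability.AlgebraicComplexity

open Literature.NumberTheory.DiophantineGeometry (kroneckerCoeff kroneckerCoeff_transpose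
  kroneckerCoeff_transpose₁₂ kroneckerCoeff_indiscrete_pos kroneckerCoeff_indiscrete_transpose_pos
  getD_sortedParts_transpose getD_sortedParts_indiscrete_transpose kroneckerCoeff_comm₁₂_holds
  kroneckerCoeff_comm₂₃_holds)
open Literature.Computability.Complexity
open Literature.RepresentationTheory.FiniteGroups.MNEval (kronSum kroneckerCoeff_pos_iff_kronSum_pos
  factorial_mul_kroneckerCoeff_eq_kronSum sort_coe_eq_of_pairwise)

/-! ### Shapes through their rows -/

section Rows

variable {M : ℕ}

/-- Sorting a constant multiset. [folklore] -/
private theorem sort_replicate (n y : ℕ) :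
    (Multiset.replicate n y).sort (· ≥ ·) = List.replicate n y := by
  induction n with
  | zero => simp
  | succ n ih =>
    rw [Multiset.replicate_succ, Multiset.sort_cons, ih, List.replicate_succ]
    intro b hb
    rw [Multiset.eq_of_mem_replicate hb]

/-- The rows of a partition with parts `{x, y, …, y}` (`k` copies of `y ≤ x`): `x`, then `k` rows
`y`. [folklore] -/
private theorem getD_sortedParts_of_parts_eq_cons_replicate {lam : Nat.Partition M} {x y k : ℕ}
    (hyx : y ≤ x) (hlam : lam.parts = x ::ₘ Multiset.replicate k y) (r : ℕ) :
    lam.sortedParts.getD r 0 = if r = 0 then x else if r ≤ k then y else 0 := by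
  have hs : lam.sortedParts = x :: List.replicate k y := by
    unfold Nat.Partition.sortedParts
    rw [hlam, Multiset.sort_cons, sort_replicate]
    intro b hb
    rw [Multiset.eq_of_mem_replicate hb]
    exact hyx
  rw [hs]
  cases r with
  | zero => simp
  | succ r =>
    rw [List.getD_cons_succ, List.getD_eq_getElem?_getD, List.getElem?_replicate,
      if_neg (Nat.succ_ne_zero r)]
    by_cases hr : r < k
    · rw [if_pos hr, if_pos (by omega)]; rfl
    · rw [if_neg hr, if_neg (by omega)]; rfl

/-- The entries of a constant list, zero-padded. [folklore] -/
private theorem getD_replicate (n x t : ℕ) : (List.replicate n x).getD t 0 = if t < n then x else 0 := by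
  rw [List.getD_eq_getElem?_getD, List.getElem?_replicate]
  split_ifs <;> rfl

/-- A zero-padded list entry that is nonzero is a member of the list. [folklore] -/
private theorem mem_of_getD_ne_zero {l : List ℕ} {t : ℕ} (h : l.getD t 0 ≠ 0) : l.getD t 0 ∈ l := by
  by_cases ht : t < l.length
  · rw [List.getD_eq_getElem _ _ ht]; exact List.getElem_mem ht
  · exact absurd (List.getD_eq_default _ _ (not_lt.1 ht)) h

/-- Two zero-padded row functions agree everywhere as soon as they agree below a bound beyond
which both vanish (for a list: beyond its length). [folklore] -/
private theorem getD_eq_of_forall_lt (L : List ℕ) (f : ℕ → ℕ) (B : ℕ) (hB : L.length ≤ B)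
    (hf : ∀ t, B ≤ t → f t = 0) (h : ∀ t < B, L.getD t 0 = f t) : ∀ t, L.getD t 0 = f t := by
  intro t
  by_cases ht : t < B
  · exact h t ht
  · rw [hf t (not_lt.1 ht), List.getD_eq_default _ _ (hB.trans (not_lt.1 ht))]

/-- **The stretched hook `i(m² - k, 1^k) ⊢ i m²` exists** (`k ≤ m² - 1`, `i ≥ 1`), as a partition of
`m·(im)` with parts `{i(m²-k), i, …, i}`. [cite: IkenmeyerPanova2017, Prop. 5.2 (the shapes i(m²-k, 1^k); TeX L1231–1233)] -/
theorem exists_parts_eq_stretchedHook {i m k : ℕ} (hi : 1 ≤ i) (hk : k + 1 ≤ m ^ 2) :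
    ∃ lam : Nat.Partition (m * (i * m)), lam.parts = (i * (m ^ 2 - k)) ::ₘ Multiset.replicate k i := by
  refine ⟨⟨(i * (m ^ 2 - k)) ::ₘ Multiset.replicate k i, fun {x} hx => ?_, ?_⟩, rfl⟩
  · rcases Multiset.mem_cons.1 hx with rfl | hx
    · exact Nat.mul_pos (by omega) (by omega)
    · rw [Multiset.eq_of_mem_replicate hx]; omega
  · rw [Multiset.sum_cons, Multiset.sum_replicate, smul_eq_mul]
    have e : m ^ 2 - k + k = m ^ 2 := Nat.sub_add_cancel (by omega)
    calc i * (m ^ 2 - k) + k * i = i * (m ^ 2 - k + k) := by ring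
      _ = m * (i * m) := by rw [e]; ring

/-- **The rows of the stretched hook** `i(m² - k, 1^k)`: `i(m²-k)`, then `k` rows `i`.
[cite: IkenmeyerPanova2017, Prop. 5.2 (the shapes i(m²-k, 1^k); TeX L1231–1233)] -/
theorem stretchedHook_rows {lam : Nat.Partition M} {i m k : ℕ} (hk : k + 1 ≤ m ^ 2)
    (hlam : lam.parts = (i * (m ^ 2 - k)) ::ₘ Multiset.replicate k i) (r : ℕ) :
    lam.sortedParts.getD r 0 = if r = 0 then i * (m ^ 2 - k) else if r ≤ k then i else 0 :=
  getD_sortedParts_of_parts_eq_cons_replicate (Nat.le_mul_of_pos_right i (by omega)) hlam r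

end Rows

/-! ### Adding stretched hooks: `a(m²-k, 1^k) + b(m²-k, 1^k) = (a+b)(m²-k, 1^k)` (the semigroup move
of the printed proof: "`i = 2i₁ + 3i₂` … apply the semigroup property") -/

section Stretch

/-- **Adding two stretched hooks against their frames**: if `g(a(m²-k,1^k), m × am, m × am) > 0` and
`g(b(m²-k,1^k), m × bm, m × bm) > 0` then `g((a+b)(m²-k,1^k), m × (a+b)m, m × (a+b)m) > 0` — the
semigroup property (tree: `ikenmeyerPanova2017_semigroup_holds`), row-wise sums of the shapes and of
the rectangles. [cite: IkenmeyerPanova2017, Prop. 5.2 (proof: "we apply the semigroup property for i₁ many double hooks plus i₂ many triple hooks"; TeX L1237–1239)] -/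
theorem stretchedHook_pos_add {m k a b : ℕ} (ha : 1 ≤ a) (hb : 1 ≤ b) (hk : k + 1 ≤ m ^ 2)
    (hPa : ∀ lam : Nat.Partition (m * (a * m)),
      lam.parts = (a * (m ^ 2 - k)) ::ₘ Multiset.replicate k a →
      0 < kroneckerCoeff ℂ lam (Nat.Partition.rectangle m (a * m)) (Nat.Partition.rectangle m (a * m)))
    (hPb : ∀ lam : Nat.Partition (m * (b * m)),
      lam.parts = (b * (m ^ 2 - k)) ::ₘ Multiset.replicate k b →
      0 < kroneckerCoeff ℂ lam (Nat.Partition.rectangle m (b * m)) (Nat.Partition.rectangle m (b * m)))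
    (lam : Nat.Partition (m * ((a + b) * m)))
    (hlam : lam.parts = ((a + b) * (m ^ 2 - k)) ::ₘ Multiset.replicate k (a + b)) :
    0 < kroneckerCoeff ℂ lam (Nat.Partition.rectangle m ((a + b) * m))
      (Nat.Partition.rectangle m ((a + b) * m)) := by
  obtain ⟨la, hla⟩ := exists_parts_eq_stretchedHook (i := a) (m := m) ha hk
  obtain ⟨lb, hlb⟩ := exists_parts_eq_stretchedHook (i := b) (m := m) hb hk
  have h := ikenmeyerPanova2017_semigroup_holds _ _ _ _ _ _ (hPa la hla) (hPb lb hlb)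
  have hR : ((Nat.Partition.rectangle m (a * m)).rowAdd (Nat.Partition.rectangle m (b * m))).parts =
      (Nat.Partition.rectangle m ((a + b) * m)).parts := by
    rw [rowAdd_rectangle_parts, ← add_mul]
  have hL : (la.rowAdd lb).parts = lam.parts :=
    parts_eq_of_getD_sortedParts_eq fun r => by
      rw [getD_sortedParts_rowAdd, stretchedHook_rows hk hla, stretchedHook_rows hk hlb,
        stretchedHook_rows hk hlam]
      split_ifs <;> ring
  rwa [kroneckerCoeff_congr_parts (by ring : m * (a * m) + m * (b * m) = m * ((a + b) * m)) hL hR hR]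
    at h

/-- **From the simple hook to every stretching factor**: if `g((m²-k,1^k), m × m, m × m) > 0` then
`g(i(m²-k,1^k), m × im, m × im) > 0` for all `i ≥ 1` (semigroup property, `i` copies).
[cite: IkenmeyerPanova2017, Prop. 5.2 (proof: "follows from the hook positivity"; TeX L1235–1236)] -/
theorem stretchedHook_pos_of_one {m k : ℕ} (hk : k + 1 ≤ m ^ 2)
    (hP1 : ∀ lam : Nat.Partition (m * (1 * m)),
      lam.parts = (1 * (m ^ 2 - k)) ::ₘ Multiset.replicate k 1 →
      0 < kroneckerCoeff ℂ lam (Nat.Partition.rectangle m (1 * m)) (Nat.Partition.rectangle m (1 * m))) :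
    ∀ i, 1 ≤ i → ∀ lam : Nat.Partition (m * (i * m)),
      lam.parts = (i * (m ^ 2 - k)) ::ₘ Multiset.replicate k i →
      0 < kroneckerCoeff ℂ lam (Nat.Partition.rectangle m (i * m)) (Nat.Partition.rectangle m (i * m)) := by
  intro i hi
  induction i, hi using Nat.le_induction with
  | base => exact hP1
  | succ i hi ih => exact stretchedHook_pos_add hi le_rfl hk ih hP1

/-- **From the double and triple hooks to every stretching factor `i ≥ 2`**: "For `i ≥ 4` we have
that `i = 2i₁ + 3i₂` for some `i₁, i₂ ≥ 0`, and then we apply the semigroup property for `i₁` many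
double hooks plus `i₂` many triple hooks" (here: `i = (i - 2) + 2`).
[cite: IkenmeyerPanova2017, Prop. 5.2 (proof; TeX L1237–1239)] -/
theorem stretchedHook_pos_of_two_three {m k : ℕ} (hk : k + 1 ≤ m ^ 2)
    (hP2 : ∀ lam : Nat.Partition (m * (2 * m)),
      lam.parts = (2 * (m ^ 2 - k)) ::ₘ Multiset.replicate k 2 →
      0 < kroneckerCoeff ℂ lam (Nat.Partition.rectangle m (2 * m)) (Nat.Partition.rectangle m (2 * m)))
    (hP3 : ∀ lam : Nat.Partition (m * (3 * m)),
      lam.parts = (3 * (m ^ 2 - k)) ::ₘ Multiset.replicate k 3 →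
      0 < kroneckerCoeff ℂ lam (Nat.Partition.rectangle m (3 * m)) (Nat.Partition.rectangle m (3 * m))) :
    ∀ i, 2 ≤ i → ∀ lam : Nat.Partition (m * (i * m)),
      lam.parts = (i * (m ^ 2 - k)) ::ₘ Multiset.replicate k i →
      0 < kroneckerCoeff ℂ lam (Nat.Partition.rectangle m (i * m)) (Nat.Partition.rectangle m (i * m)) := by
  intro i hi
  induction i using Nat.strong_induction_on with
  | _ i ih =>
    rcases (show i = 2 ∨ i = 3 ∨ 4 ≤ i by omega) with rfl | rfl | h4
    · exact hP2
    · exact hP3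
    · obtain ⟨j, rfl⟩ : ∃ j, i = j + 2 := ⟨i - 2, by omega⟩
      exact stretchedHook_pos_add (by omega) (by omega) hk (ih j (by omega) (by omega)) hP2

/-- **Case `k ∉ {1, 2, 4, 6, m²-7, m²-5, m²-3, m²-2}`, `i = 1`**: the hook positivity against the
square, `g((m²-k,1^k), m × m, m × m) > 0` — the tree's `ikenmeyerPanova2017_cor_4_4_square` (IP
Cor. 4.5 / Thm. 6.1), transported to the written size `m·(1·m)`.
[cite: IkenmeyerPanova2017, Prop. 5.2 (proof: "the proposition follows from the hook positivity as long as k ≠ 1,2,4,6, m²-7, m²-5, m²-3, m²-2"; TeX L1235–1236)] -/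
theorem stretchedHook_pos_one_of_admissible {m k : ℕ} (hm : 7 ≤ m) (hk : k < m ^ 2) (h1 : k ≠ 1)
    (h2 : k ≠ 2) (h4 : k ≠ 4) (h6 : k ≠ 6) (h2' : k + 2 ≠ m ^ 2) (h3' : k + 3 ≠ m ^ 2)
    (h5' : k + 5 ≠ m ^ 2) (h7' : k + 7 ≠ m ^ 2) :
    ∀ lam : Nat.Partition (m * (1 * m)),
      lam.parts = (1 * (m ^ 2 - k)) ::ₘ Multiset.replicate k 1 →
      0 < kroneckerCoeff ℂ lam (Nat.Partition.rectangle m (1 * m)) (Nat.Partition.rectangle m (1 * m)) := by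
  intro lam hlam
  let lam' : Nat.Partition (m * m) := ⟨lam.parts, lam.parts_pos, by rw [lam.parts_sum]; ring⟩
  have hlam' : lam'.parts = (m * m - k) ::ₘ Multiset.replicate k 1 := by
    change lam.parts = _
    rw [hlam, one_mul, sq]
  have h := ikenmeyerPanova2017_cor_4_4_square hm hk h1 h2 h4 h6 h2' h3' h5' h7' lam' hlam'
  have hR : (Nat.Partition.rectangle m m).parts = (Nat.Partition.rectangle m (1 * m)).parts := by
    rw [one_mul]
  rwa [kroneckerCoeff_congr_parts (by ring : m * m = m * (1 * m)) (lam' := lam)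
    (show lam'.parts = lam.parts from rfl) hR hR] at h

/-- **Small bodies from a kernel computation**: if the decreasing list `L ⊢ cd` with rows `i` in
positions `1, …, k` (and `|L| ≤ k + 1`) is positive against `c × d` by the verified evaluator
(`0 < kronSum`), then for every `m ≥ c` with `im ≥ d` the stretched hook `i(m²-k, 1^k)` is positive
against `m × im` — growth of the frame (tree: `pos_rows_of_kronSum`,
`kroneckerCoeff_pos_of_frame_le`). This replaces the printed "finite calculations for `i = 2, 3`
and `m = 7`" (Kronecker coefficients of `𝔖_98`, `𝔖_147`) by smaller frames.
[cite: IkenmeyerPanova2017, Prop. 5.2 (proof, case k ∈ {1,2,4,6}: "finite calculations for i=2,3 and m=7 give positive values"; TeX L1236–1237)] -/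
theorem stretchedHook_pos_of_kronSum {i m k c d : ℕ} (hk : k + 1 ≤ m ^ 2) (hd : d ≠ 0)
    (L : List ℕ) (hLpos : ∀ x ∈ L, 0 < x) (hLsum : L.sum = c * d) (hLsorted : L.Pairwise (· ≥ ·))
    (hLB : L.length ≤ k + 1) (hrows : ∀ r < k, L.getD (r + 1) 0 = i)
    (hpos : 0 < kronSum (c * d) L (List.replicate c d) (List.replicate c d)) (hcm : c ≤ m)
    (hdm : d ≤ i * m) :
    ∀ lam : Nat.Partition (m * (i * m)),
      lam.parts = (i * (m ^ 2 - k)) ::ₘ Multiset.replicate k i →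
      0 < kroneckerCoeff ℂ lam (Nat.Partition.rectangle m (i * m)) (Nat.Partition.rectangle m (i * m)) := by
  intro lam hlam
  refine pos_rows_of_kronSum hd L hLpos hLsum hLsorted (fun r => if r < k then i else 0) k
    (fun r hr => if_neg (by omega)) hLB (fun r hr => by rw [hrows r hr, if_pos hr]) hpos hcm hdm lam
    fun r => ?_
  show lam.sortedParts.getD (r + 1) 0 = if r < k then i else 0
  rw [stretchedHook_rows hk hlam, if_neg (Nat.succ_ne_zero r)]
  by_cases hr : r < k
  · rw [if_pos (Nat.succ_le_of_lt hr), if_pos hr]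
  · rw [if_neg (fun h => hr (Nat.lt_of_succ_le h)), if_neg hr]

/-- `i = 2`, `k = 1`: body `(2)` is positive against `2 × 2` (tree `ipcComp_2_2_1`,
`g((2,2),(2,2),(2,2)) = 1`). [cite: IkenmeyerPanova2017, Prop. 5.2 (proof, case k = 1, i = 2)] -/
theorem stretchedHook_pos_two_one {m : ℕ} (hm : 7 ≤ m) :
    ∀ lam : Nat.Partition (m * (2 * m)),
      lam.parts = (2 * (m ^ 2 - 1)) ::ₘ Multiset.replicate 1 2 →
      0 < kroneckerCoeff ℂ lam (Nat.Partition.rectangle m (2 * m)) (Nat.Partition.rectangle m (2 * m)) :=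
  stretchedHook_pos_of_kronSum (c := 2) (d := 2) (by nlinarith) (by norm_num) [2, 2]
    (by decide) (by decide) (by decide) (by decide) (by decide) ipcComp_2_2_1 (by omega) (by omega)

/-- `i = 2`, `k = 2`: body `(2,2)` is positive against `2 × 3` (tree `ipcComp_2_3_1`).
[cite: IkenmeyerPanova2017, Prop. 5.2 (proof, case k = 2, i = 2)] -/
theorem stretchedHook_pos_two_two {m : ℕ} (hm : 7 ≤ m) :
    ∀ lam : Nat.Partition (m * (2 * m)),
      lam.parts = (2 * (m ^ 2 - 2)) ::ₘ Multiset.replicate 2 2 →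
      0 < kroneckerCoeff ℂ lam (Nat.Partition.rectangle m (2 * m)) (Nat.Partition.rectangle m (2 * m)) :=
  stretchedHook_pos_of_kronSum (c := 2) (d := 3) (by nlinarith) (by norm_num) [2, 2, 2]
    (by decide) (by decide) (by decide) (by decide) (by decide) ipcComp_2_3_1 (by omega) (by omega)

/-- `i = 2`, `k = 4`: body `(2⁴)` is positive against `3 × 4` (tree `ipcComp_3_4_9`).
[cite: IkenmeyerPanova2017, Prop. 5.2 (proof, case k = 4, i = 2)] -/
theorem stretchedHook_pos_two_four {m : ℕ} (hm : 7 ≤ m) :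
    ∀ lam : Nat.Partition (m * (2 * m)),
      lam.parts = (2 * (m ^ 2 - 4)) ::ₘ Multiset.replicate 4 2 →
      0 < kroneckerCoeff ℂ lam (Nat.Partition.rectangle m (2 * m)) (Nat.Partition.rectangle m (2 * m)) :=
  stretchedHook_pos_of_kronSum (c := 3) (d := 4) (by nlinarith) (by norm_num)
    [4, 2, 2, 2, 2] (by decide) (by decide) (by decide) (by decide) (by decide) ipcComp_3_4_9
    (by omega) (by omega)

/-- `i = 2`, `k = 6`: body `(2⁶)` is positive against `3 × 5` (tree `ipcComp_3_5_11`).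
[cite: IkenmeyerPanova2017, Prop. 5.2 (proof, case k = 6, i = 2)] -/
theorem stretchedHook_pos_two_six {m : ℕ} (hm : 7 ≤ m) :
    ∀ lam : Nat.Partition (m * (2 * m)),
      lam.parts = (2 * (m ^ 2 - 6)) ::ₘ Multiset.replicate 6 2 →
      0 < kroneckerCoeff ℂ lam (Nat.Partition.rectangle m (2 * m)) (Nat.Partition.rectangle m (2 * m)) :=
  stretchedHook_pos_of_kronSum (c := 3) (d := 5) (by nlinarith) (by norm_num)
    [3, 2, 2, 2, 2, 2, 2] (by decide) (by decide) (by decide) (by decide) (by decide) ipcComp_3_5_11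
    (by omega) (by omega)

/-- `i = 3`, `k = 1`: body `(3)` is positive against `3 × 3` (tree `ipcComp_3_3_1`).
[cite: IkenmeyerPanova2017, Prop. 5.2 (proof, case k = 1, i = 3)] -/
theorem stretchedHook_pos_three_one {m : ℕ} (hm : 7 ≤ m) :
    ∀ lam : Nat.Partition (m * (3 * m)),
      lam.parts = (3 * (m ^ 2 - 1)) ::ₘ Multiset.replicate 1 3 →
      0 < kroneckerCoeff ℂ lam (Nat.Partition.rectangle m (3 * m)) (Nat.Partition.rectangle m (3 * m)) :=
  stretchedHook_pos_of_kronSum (c := 3) (d := 3) (by nlinarith) (by norm_num) [6, 3]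
    (by decide) (by decide) (by decide) (by decide) (by decide) ipcComp_3_3_1 (by omega) (by omega)

/-- `i = 3`, `k = 2`: body `(3,3)` is positive against `3 × 3` (tree `ipcComp_3_3_6`, the square
positivity at `3`). [cite: IkenmeyerPanova2017, Prop. 5.2 (proof, case k = 2, i = 3)] -/
theorem stretchedHook_pos_three_two {m : ℕ} (hm : 7 ≤ m) :
    ∀ lam : Nat.Partition (m * (3 * m)),
      lam.parts = (3 * (m ^ 2 - 2)) ::ₘ Multiset.replicate 2 3 →
      0 < kroneckerCoeff ℂ lam (Nat.Partition.rectangle m (3 * m)) (Nat.Partition.rectangle m (3 * m)) :=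
  stretchedHook_pos_of_kronSum (c := 3) (d := 3) (by nlinarith) (by norm_num) [3, 3, 3]
    (by decide) (by decide) (by decide) (by decide) (by decide) ipcComp_3_3_6 (by omega) (by omega)

/-- `i = 3`, `k = 4`: body `(3⁴)` is positive against `3 × 5` (tree `ipcComp_3_5_8`).
[cite: IkenmeyerPanova2017, Prop. 5.2 (proof, case k = 4, i = 3)] -/
theorem stretchedHook_pos_three_four {m : ℕ} (hm : 7 ≤ m) :
    ∀ lam : Nat.Partition (m * (3 * m)),
      lam.parts = (3 * (m ^ 2 - 4)) ::ₘ Multiset.replicate 4 3 →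
      0 < kroneckerCoeff ℂ lam (Nat.Partition.rectangle m (3 * m)) (Nat.Partition.rectangle m (3 * m)) :=
  stretchedHook_pos_of_kronSum (c := 3) (d := 5) (by nlinarith) (by norm_num)
    [3, 3, 3, 3, 3] (by decide) (by decide) (by decide) (by decide) (by decide) ipcComp_3_5_8
    (by omega) (by omega)

/-- `i = 3`, `k = 6`: body `(3⁶)` is positive against `4 × 6` (tree `ipcComp_4_6_1`, `𝔖_24`).
[cite: IkenmeyerPanova2017, Prop. 5.2 (proof, case k = 6, i = 3)] -/
theorem stretchedHook_pos_three_six {m : ℕ} (hm : 7 ≤ m) :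
    ∀ lam : Nat.Partition (m * (3 * m)),
      lam.parts = (3 * (m ^ 2 - 6)) ::ₘ Multiset.replicate 6 3 →
      0 < kroneckerCoeff ℂ lam (Nat.Partition.rectangle m (3 * m)) (Nat.Partition.rectangle m (3 * m)) :=
  stretchedHook_pos_of_kronSum (c := 4) (d := 6) (by nlinarith) (by norm_num)
    [6, 3, 3, 3, 3, 3, 3] (by decide) (by decide) (by decide) (by decide) (by decide) ipcComp_4_6_1
    (by omega) (by omega)

end Stretch

/-! ### The printed Claim for the four large legs `k ∈ {m²-7, m²-5, m²-3, m²-2}`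

For `r = m² - 1 - k ∈ {6, 4, 2, 1}` and `i ∈ {2, 3}` the printed proof transposes the stretched hook:
`μ^i[a,b] := ((ab-r)^i, 1^{ir})`, `μ^i[m,m] = (i(m²-k,1^k))ᵗ`, "so by transposing one of the
rectangles the statement to prove is equivalent to showing that `g(μ^i[m,m], (im) × m, m × (im)) > 0`",
and proves the **Claim** "`g(μ^i[a,b], (ia) × b, a × (bi)) > 0`" by induction on `(a, b)`: adding the
positive triple `(a^i, 1^{ia}, i^a)` (from `g((ia), (a^i), (a^i)) > 0` by transposing the first two
partitions) passes from `(a, b)` to `(a, b+1)`, and the Claim is symmetric in `a`, `b`. Below, the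
Claim at `(i, r, a, b)` is the statement: for all `μ, R₂ ⊢ iab` with rows
`μ = ((ab-r)^i, 1^{ir})` and `R₂ = a × (ib)`, `g(μ, (ia) × b, R₂) > 0` (shapes by their rows; the
rectangle `(ia) × b` = `Nat.Partition.rectangle (i*a) b` has the right written size). -/

section Claim

/-- **Induction step of the Claim, `(a, b) ↦ (a, b+1)`** (printed: "Since `g((ia₀), (a₀^i), (a₀^i)) > 0`
after transposing the first two partitions … `g(a₀^i, 1^{ia₀}, i^{a₀}) > 0`. Add this triple to
`μ^i[a₀,b₀], (ia₀) × b₀, a₀ × (b₀ i)`, applying the semigroup property …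
`= g(μ^i[a₀,b₀+1], (ia₀) × (b₀+1), a₀ × (b₀+1)i)`"). The added triple is the tree's
`kroneckerCoeff_indiscrete_transpose_pos` (`g((1^n), ρ, ρᵗ) > 0`) rearranged; the shapes are built
with `partitionOfRows`. [cite: IkenmeyerPanova2017, Prop. 5.2 (proof of the Claim, induction step; TeX L1250–1258)] -/
theorem stretchedHook_claim_step {i r a b : ℕ} (hr : r < a * b)
    (hC : ∀ (mu R₂ : Nat.Partition (i * a * b)),
      (∀ t, mu.sortedParts.getD t 0 = if t < i then a * b - r else if t < i + i * r then 1 else 0) →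
      (∀ t, R₂.sortedParts.getD t 0 = if t < a then i * b else 0) →
      0 < kroneckerCoeff ℂ mu (Nat.Partition.rectangle (i * a) b) R₂) :
    ∀ (mu R₂ : Nat.Partition (i * a * (b + 1))),
      (∀ t, mu.sortedParts.getD t 0 =
        if t < i then a * (b + 1) - r else if t < i + i * r then 1 else 0) →
      (∀ t, R₂.sortedParts.getD t 0 = if t < a then i * (b + 1) else 0) →
      0 < kroneckerCoeff ℂ mu (Nat.Partition.rectangle (i * a) (b + 1)) R₂ := by
  intro mu R₂ hmu hR₂
  -- the shapes at `(a, b)`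
  set w : ℕ → ℕ := fun t => if t < i then a * b - r else if t < i + i * r then 1 else 0 with hw
  have hw_anti : Antitone w := by
    intro s t hst
    simp only [hw]
    split_ifs <;> omega
  have hw_sum : ∑ t ∈ Finset.range (i + i * r), w t = i * a * b := by
    rw [Finset.sum_range_add]
    have h1 : ∑ t ∈ Finset.range i, w t = ∑ t ∈ Finset.range i, (a * b - r) :=
      Finset.sum_congr rfl fun t ht => by
        simp only [hw, if_pos (Finset.mem_range.1 ht)]
    have h2 : ∑ t ∈ Finset.range (i * r), w (i + t) = ∑ t ∈ Finset.range (i * r), 1 :=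
      Finset.sum_congr rfl fun t ht => by
        have ht' := Finset.mem_range.1 ht
        simp only [hw, if_neg (show ¬ (i + t < i) by omega), if_pos (show i + t < i + i * r by omega)]
    rw [h1, h2, Finset.sum_const, Finset.sum_const, Finset.card_range, Finset.card_range, smul_eq_mul,
      smul_eq_mul, mul_one]
    have e : a * b - r + r = a * b := Nat.sub_add_cancel hr.le
    calc i * (a * b - r) + i * r = i * (a * b - r + r) := by ring
      _ = i * a * b := by rw [e]; ring
  set v : ℕ → ℕ := fun t => if t < a then i * b else 0 with hv
  have hv_anti : Antitone v := by
    intro s t hst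
    simp only [hv]
    split_ifs <;> omega
  have hv_sum : ∑ t ∈ Finset.range a, v t = i * a * b := by
    rw [Finset.sum_congr rfl fun t ht => show v t = i * b by
        simp only [hv, if_pos (Finset.mem_range.1 ht)],
      Finset.sum_const, Finset.card_range, smul_eq_mul]
    ring
  have hmu₀ := getD_sortedParts_partitionOfRows hw_anti hw_sum
  have hR₀ := getD_sortedParts_partitionOfRows hv_anti hv_sum
  have h0 := hC (partitionOfRows w (i + i * r) (i * a * b)) (partitionOfRows v a (i * a * b))
    (fun t => by rw [hmu₀ t]; simp only [hw]; split_ifs <;> omega)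
    (fun t => by rw [hR₀ t]; simp only [hv]; split_ifs <;> omega)
  -- the added triple `(a^i, 1^{ia}, i^a)`
  have hT : 0 < kroneckerCoeff ℂ (Nat.Partition.rectangle i a)
      (Nat.Partition.indiscrete (i * a)).transpose (Nat.Partition.rectangle i a).transpose := by
    have h := kroneckerCoeff_indiscrete_transpose_pos ℂ (Nat.Partition.rectangle i a)
    rwa [kroneckerCoeff_comm₁₂_holds ℂ] at h
  have hS := ikenmeyerPanova2017_semigroup_holds _ _ _ _ _ _ h0 hT
  -- the rows of the three sums
  have hrT : ∀ t, (Nat.Partition.rectangle i a).transpose.sortedParts.getD t 0 = if t < a then i else 0 :=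
    fun t => by rw [sortedParts_congr_parts (transpose_rectangle_parts i a), getD_sortedParts_rectangle]
  have h1 : ((partitionOfRows w (i + i * r) (i * a * b)).rowAdd (Nat.Partition.rectangle i a)).parts =
      mu.parts :=
    parts_eq_of_getD_sortedParts_eq fun t => by
      rw [getD_sortedParts_rowAdd, hmu₀ t, getD_sortedParts_rectangle, hmu t]
      simp only [hw]
      split_ifs <;> first | omega | (rw [Nat.mul_succ]; omega)
  have h2 : ((Nat.Partition.rectangle (i * a) b).rowAdd (Nat.Partition.indiscrete (i * a)).transpose).parts =
      (Nat.Partition.rectangle (i * a) (b + 1)).parts :=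
    parts_eq_of_getD_sortedParts_eq fun t => by
      rw [getD_sortedParts_rowAdd, getD_sortedParts_rectangle, getD_sortedParts_indiscrete_transpose,
        getD_sortedParts_rectangle]
      split_ifs <;> rfl
  have h3 : ((partitionOfRows v a (i * a * b)).rowAdd (Nat.Partition.rectangle i a).transpose).parts =
      R₂.parts :=
    parts_eq_of_getD_sortedParts_eq fun t => by
      rw [getD_sortedParts_rowAdd, hR₀ t, hrT t, hR₂ t]
      simp only [hv]
      split_ifs <;> first | omega | (rw [Nat.mul_succ]) 
  rwa [kroneckerCoeff_congr_parts (by ring : i * a * b + i * a = i * a * (b + 1)) h1 h2 h3] at hS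

/-- **Symmetry of the Claim in `a`, `b`** ("By the symmetry between `a` and `b`, we also have the
statement for `(a₀+1, b₀)`"): transpose both rectangles (`g(λ, μ, ν) = g(λ, μᵗ, νᵗ)`, tree
`kroneckerCoeff_transpose`) and exchange them. [cite: IkenmeyerPanova2017, Prop. 5.2 (proof of the Claim, symmetry in a, b; TeX L1259)] -/
theorem stretchedHook_claim_symm {i r a b : ℕ}
    (hC : ∀ (mu R₂ : Nat.Partition (i * a * b)),
      (∀ t, mu.sortedParts.getD t 0 = if t < i then a * b - r else if t < i + i * r then 1 else 0) →
      (∀ t, R₂.sortedParts.getD t 0 = if t < a then i * b else 0) →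
      0 < kroneckerCoeff ℂ mu (Nat.Partition.rectangle (i * a) b) R₂) :
    ∀ (mu R₂ : Nat.Partition (i * b * a)),
      (∀ t, mu.sortedParts.getD t 0 = if t < i then b * a - r else if t < i + i * r then 1 else 0) →
      (∀ t, R₂.sortedParts.getD t 0 = if t < b then i * a else 0) →
      0 < kroneckerCoeff ℂ mu (Nat.Partition.rectangle (i * b) a) R₂ := by
  intro mu R₂ hmu hR₂
  let mu₀ : Nat.Partition (i * a * b) := ⟨mu.parts, mu.parts_pos, by rw [mu.parts_sum]; ring⟩
  have hmu₀ : ∀ t, mu₀.sortedParts.getD t 0 =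
      if t < i then a * b - r else if t < i + i * r then 1 else 0 := fun t => by
    rw [sortedParts_congr_parts (show mu₀.parts = mu.parts from rfl), hmu t, mul_comm b a]
  set v : ℕ → ℕ := fun t => if t < a then i * b else 0 with hv
  have hv_anti : Antitone v := by
    intro s t hst
    simp only [hv]
    split_ifs <;> omega
  have hv_sum : ∑ t ∈ Finset.range a, v t = i * a * b := by
    rw [Finset.sum_congr rfl fun t ht => show v t = i * b by
        simp only [hv, if_pos (Finset.mem_range.1 ht)],
      Finset.sum_const, Finset.card_range, smul_eq_mul]
    ring
  have hR₀ := getD_sortedParts_partitionOfRows hv_anti hv_sum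
  have h0 := hC mu₀ (partitionOfRows v a (i * a * b)) hmu₀
    (fun t => by rw [hR₀ t]; simp only [hv]; split_ifs <;> omega)
  rw [kroneckerCoeff_transpose ℂ, kroneckerCoeff_comm₂₃_holds ℂ] at h0
  -- `h0 : 0 < g(μ, R₀ᵗ, ((ia) × b)ᵗ)`
  have h2 : (partitionOfRows v a (i * a * b)).transpose.parts = (Nat.Partition.rectangle (i * b) a).parts :=
    parts_eq_of_getD_sortedParts_eq fun t => by
      rw [getD_sortedParts_transpose, getD_sortedParts_rectangle]
      refine colLen_eq_of_forall _ fun s => ?_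
      rw [hR₀ s]
      simp only [hv]
      split_ifs <;> omega
  have h3 : (Nat.Partition.rectangle (i * a) b).transpose.parts = R₂.parts := by
    rw [transpose_rectangle_parts]
    exact parts_eq_of_getD_sortedParts_eq fun t => by rw [getD_sortedParts_rectangle, hR₂ t]
  rwa [kroneckerCoeff_congr_parts (by ring : i * a * b = i * b * a) (lam' := mu)
    (show mu₀.parts = mu.parts from rfl) h2 h3] at h0

/-- **The Claim for all `(a, b) ≥ (a₀, a₀)` from the base `(a₀, a₀)`** ("We prove this claim by
induction on `(a,b)` … so by induction the claim holds for all `(a,b)`"): steps in `b`, symmetry,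
steps in the other variable. (The printed base is `(7,7)`, computed; the files
`IP17StretchedHookComputations*` supply the smaller bases `(2,2)` / `(3,3)` used below.)
[cite: IkenmeyerPanova2017, Prop. 5.2 (proof of the Claim, the induction; TeX L1248–1260)] -/
theorem stretchedHook_claim_of_base {i r a₀ : ℕ} (hr : r < a₀ * a₀)
    (hbase : ∀ (mu R₂ : Nat.Partition (i * a₀ * a₀)),
      (∀ t, mu.sortedParts.getD t 0 = if t < i then a₀ * a₀ - r else if t < i + i * r then 1 else 0) →
      (∀ t, R₂.sortedParts.getD t 0 = if t < a₀ then i * a₀ else 0) →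
      0 < kroneckerCoeff ℂ mu (Nat.Partition.rectangle (i * a₀) a₀) R₂) :
    ∀ a b, a₀ ≤ a → a₀ ≤ b → ∀ (mu R₂ : Nat.Partition (i * a * b)),
      (∀ t, mu.sortedParts.getD t 0 = if t < i then a * b - r else if t < i + i * r then 1 else 0) →
      (∀ t, R₂.sortedParts.getD t 0 = if t < a then i * b else 0) →
      0 < kroneckerCoeff ℂ mu (Nat.Partition.rectangle (i * a) b) R₂ := by
  -- first along `b` from `(a₀, a₀)`
  have h1 : ∀ b, a₀ ≤ b → ∀ (mu R₂ : Nat.Partition (i * a₀ * b)),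
      (∀ t, mu.sortedParts.getD t 0 = if t < i then a₀ * b - r else if t < i + i * r then 1 else 0) →
      (∀ t, R₂.sortedParts.getD t 0 = if t < a₀ then i * b else 0) →
      0 < kroneckerCoeff ℂ mu (Nat.Partition.rectangle (i * a₀) b) R₂ := by
    intro b hb
    induction b, hb using Nat.le_induction with
    | base => exact hbase
    | succ b hb ih =>
      exact stretchedHook_claim_step (lt_of_lt_of_le hr (Nat.mul_le_mul_left a₀ hb)) ih
  intro a b ha hb
  induction b, hb using Nat.le_induction with
  | base => exact stretchedHook_claim_symm (h1 a ha)
  | succ b hb ih =>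
    exact stretchedHook_claim_step (lt_of_lt_of_le hr (Nat.mul_le_mul ha hb)) ih

/-- **A base of the Claim from a kernel computation**: if the explicit decreasing list `L` has the
rows of `μ^i[a,b]` and `0 < kronSum (iab) L ((ia) × b) (a × (ib))` (the verified evaluator), the
Claim holds at `(i, r, a, b)`. [cite: IkenmeyerPanova2017, Prop. 5.2 (proof of the Claim: "initial condition computationally verified"; TeX L1251–1252)] -/
theorem stretchedHook_claim_base_of_kronSum {i r a b : ℕ} (hb : b ≠ 0) (hib : i * b ≠ 0) (L : List ℕ)
    (hLpos : ∀ x ∈ L, 0 < x)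
    (hL : ∀ t, L.getD t 0 = if t < i then a * b - r else if t < i + i * r then 1 else 0)
    (hpos : 0 < kronSum (i * a * b) L (List.replicate (i * a) b) (List.replicate a (i * b))) :
    ∀ (mu R₂ : Nat.Partition (i * a * b)),
      (∀ t, mu.sortedParts.getD t 0 = if t < i then a * b - r else if t < i + i * r then 1 else 0) →
      (∀ t, R₂.sortedParts.getD t 0 = if t < a then i * b else 0) →
      0 < kroneckerCoeff ℂ mu (Nat.Partition.rectangle (i * a) b) R₂ := by
  intro mu R₂ hmu hR₂
  rw [kroneckerCoeff_pos_iff_kronSum_pos]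
  have hpos' : ∀ (μ : Nat.Partition (i * a * b)), ∀ x ∈ μ.sortedParts, 0 < x :=
    fun μ x hx => μ.parts_pos ((Multiset.mem_sort _).1 hx)
  have h1 : mu.sortedParts = L :=
    list_eq_of_getD_eq _ _ (hpos' mu) hLpos fun t => by rw [hmu t, hL t]
  have h2 : (Nat.Partition.rectangle (i * a) b).sortedParts = List.replicate (i * a) b :=
    sortedParts_rectangle _ _ hb
  have h3 : R₂.sortedParts = List.replicate a (i * b) :=
    list_eq_of_getD_eq _ _ (hpos' R₂)
      (fun x hx => by rw [List.eq_of_mem_replicate hx]; exact Nat.pos_of_ne_zero hib)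
      fun t => by rw [hR₂ t, getD_replicate]
  rw [h1, h2, h3]
  exact hpos

/-- Base `i = 2`, `(a,b) = (2,2)`, `r = 1`: `g((3,3,1,1), (2⁴), (4,4)) > 0` (`𝔖_8`,
`ipsh_kronSum_mu2_22_r1`). [cite: IkenmeyerPanova2017, Prop. 5.2 (proof of the Claim, base case)] -/
theorem stretchedHook_claim_base_2_1 :
    ∀ (mu R₂ : Nat.Partition (2 * 2 * 2)),
      (∀ t, mu.sortedParts.getD t 0 = if t < 2 then 2 * 2 - 1 else if t < 2 + 2 * 1 then 1 else 0) →
      (∀ t, R₂.sortedParts.getD t 0 = if t < 2 then 2 * 2 else 0) →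
      0 < kroneckerCoeff ℂ mu (Nat.Partition.rectangle (2 * 2) 2) R₂ :=
  stretchedHook_claim_base_of_kronSum (by norm_num) (by norm_num) [3, 3, 1, 1] (by decide)
    (getD_eq_of_forall_lt _ _ 4 (by decide) (fun t ht => by rw [if_neg (by omega), if_neg (by omega)])
      (by decide)) ipsh_kronSum_mu2_22_r1

/-- Base `i = 2`, `(a,b) = (2,2)`, `r = 2`: `g((2,2,1⁴), (2⁴), (4,4)) > 0` (`𝔖_8`,
`ipsh_kronSum_mu2_22_r2`). [cite: IkenmeyerPanova2017, Prop. 5.2 (proof of the Claim, base case)] -/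
theorem stretchedHook_claim_base_2_2 :
    ∀ (mu R₂ : Nat.Partition (2 * 2 * 2)),
      (∀ t, mu.sortedParts.getD t 0 = if t < 2 then 2 * 2 - 2 else if t < 2 + 2 * 2 then 1 else 0) →
      (∀ t, R₂.sortedParts.getD t 0 = if t < 2 then 2 * 2 else 0) →
      0 < kroneckerCoeff ℂ mu (Nat.Partition.rectangle (2 * 2) 2) R₂ :=
  stretchedHook_claim_base_of_kronSum (by norm_num) (by norm_num) [2, 2, 1, 1, 1, 1] (by decide)
    (getD_eq_of_forall_lt _ _ 6 (by decide) (fun t ht => by rw [if_neg (by omega), if_neg (by omega)])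
      (by decide)) ipsh_kronSum_mu2_22_r2

/-- Base `i = 2`, `(a,b) = (3,3)`, `r = 4`: `g((5,5,1⁸), (3⁶), (6³)) > 0` (`𝔖_18`,
`ipsh_kronSum_mu2_33_r4`). [cite: IkenmeyerPanova2017, Prop. 5.2 (proof of the Claim, base case)] -/
theorem stretchedHook_claim_base_2_4 :
    ∀ (mu R₂ : Nat.Partition (2 * 3 * 3)),
      (∀ t, mu.sortedParts.getD t 0 = if t < 2 then 3 * 3 - 4 else if t < 2 + 2 * 4 then 1 else 0) →
      (∀ t, R₂.sortedParts.getD t 0 = if t < 3 then 2 * 3 else 0) →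
      0 < kroneckerCoeff ℂ mu (Nat.Partition.rectangle (2 * 3) 3) R₂ :=
  stretchedHook_claim_base_of_kronSum (by norm_num) (by norm_num) [5, 5, 1, 1, 1, 1, 1, 1, 1, 1]
    (by decide)
    (getD_eq_of_forall_lt _ _ 10 (by decide) (fun t ht => by rw [if_neg (by omega), if_neg (by omega)])
      (by decide)) ipsh_kronSum_mu2_33_r4

/-- Base `i = 2`, `(a,b) = (3,3)`, `r = 6`: `g((3,3,1¹²), (3⁶), (6³)) > 0` (`𝔖_18`,
`ipsh_kronSum_mu2_33_r6`). [cite: IkenmeyerPanova2017, Prop. 5.2 (proof of the Claim, base case)] -/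
theorem stretchedHook_claim_base_2_6 :
    ∀ (mu R₂ : Nat.Partition (2 * 3 * 3)),
      (∀ t, mu.sortedParts.getD t 0 = if t < 2 then 3 * 3 - 6 else if t < 2 + 2 * 6 then 1 else 0) →
      (∀ t, R₂.sortedParts.getD t 0 = if t < 3 then 2 * 3 else 0) →
      0 < kroneckerCoeff ℂ mu (Nat.Partition.rectangle (2 * 3) 3) R₂ :=
  stretchedHook_claim_base_of_kronSum (by norm_num) (by norm_num)
    [3, 3, 1, 1, 1, 1, 1, 1, 1, 1, 1, 1, 1, 1] (by decide)
    (getD_eq_of_forall_lt _ _ 14 (by decide) (fun t ht => by rw [if_neg (by omega), if_neg (by omega)])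
      (by decide)) ipsh_kronSum_mu2_33_r6

/-- Base `i = 3`, `(a,b) = (3,3)`, `r = 1`: `g((8,8,8,1³), (3⁹), (9³)) > 0` (`𝔖_27`,
`ipsh_kronSum_mu3_33_r1`). [cite: IkenmeyerPanova2017, Prop. 5.2 (proof of the Claim, base case)] -/
theorem stretchedHook_claim_base_3_1 :
    ∀ (mu R₂ : Nat.Partition (3 * 3 * 3)),
      (∀ t, mu.sortedParts.getD t 0 = if t < 3 then 3 * 3 - 1 else if t < 3 + 3 * 1 then 1 else 0) →
      (∀ t, R₂.sortedParts.getD t 0 = if t < 3 then 3 * 3 else 0) →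
      0 < kroneckerCoeff ℂ mu (Nat.Partition.rectangle (3 * 3) 3) R₂ :=
  stretchedHook_claim_base_of_kronSum (by norm_num) (by norm_num) [8, 8, 8, 1, 1, 1] (by decide)
    (getD_eq_of_forall_lt _ _ 6 (by decide) (fun t ht => by rw [if_neg (by omega), if_neg (by omega)])
      (by decide)) ipsh_kronSum_mu3_33_r1

/-- Base `i = 3`, `(a,b) = (3,3)`, `r = 2`: `g((7,7,7,1⁶), (3⁹), (9³)) > 0` (`𝔖_27`,
`ipsh_kronSum_mu3_33_r2`). [cite: IkenmeyerPanova2017, Prop. 5.2 (proof of the Claim, base case)] -/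
theorem stretchedHook_claim_base_3_2 :
    ∀ (mu R₂ : Nat.Partition (3 * 3 * 3)),
      (∀ t, mu.sortedParts.getD t 0 = if t < 3 then 3 * 3 - 2 else if t < 3 + 3 * 2 then 1 else 0) →
      (∀ t, R₂.sortedParts.getD t 0 = if t < 3 then 3 * 3 else 0) →
      0 < kroneckerCoeff ℂ mu (Nat.Partition.rectangle (3 * 3) 3) R₂ :=
  stretchedHook_claim_base_of_kronSum (by norm_num) (by norm_num) [7, 7, 7, 1, 1, 1, 1, 1, 1]
    (by decide)
    (getD_eq_of_forall_lt _ _ 9 (by decide) (fun t ht => by rw [if_neg (by omega), if_neg (by omega)])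
      (by decide)) ipsh_kronSum_mu3_33_r2

/-- Base `i = 3`, `(a,b) = (3,3)`, `r = 4`: `g((5,5,5,1¹²), (3⁹), (9³)) > 0` (`𝔖_27`,
`ipsh_kronSum_mu3_33_r4`). [cite: IkenmeyerPanova2017, Prop. 5.2 (proof of the Claim, base case)] -/
theorem stretchedHook_claim_base_3_4 :
    ∀ (mu R₂ : Nat.Partition (3 * 3 * 3)),
      (∀ t, mu.sortedParts.getD t 0 = if t < 3 then 3 * 3 - 4 else if t < 3 + 3 * 4 then 1 else 0) →
      (∀ t, R₂.sortedParts.getD t 0 = if t < 3 then 3 * 3 else 0) →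
      0 < kroneckerCoeff ℂ mu (Nat.Partition.rectangle (3 * 3) 3) R₂ :=
  stretchedHook_claim_base_of_kronSum (by norm_num) (by norm_num)
    [5, 5, 5, 1, 1, 1, 1, 1, 1, 1, 1, 1, 1, 1, 1] (by decide)
    (getD_eq_of_forall_lt _ _ 15 (by decide) (fun t ht => by rw [if_neg (by omega), if_neg (by omega)])
      (by decide)) ipsh_kronSum_mu3_33_r4

/-- Base `i = 3`, `(a,b) = (3,3)`, `r = 6`: `g((3,3,3,1¹⁸), (3⁹), (9³)) > 0` (`𝔖_27`,
`ipsh_kronSum_mu3_33_r6`). [cite: IkenmeyerPanova2017, Prop. 5.2 (proof of the Claim, base case)] -/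
theorem stretchedHook_claim_base_3_6 :
    ∀ (mu R₂ : Nat.Partition (3 * 3 * 3)),
      (∀ t, mu.sortedParts.getD t 0 = if t < 3 then 3 * 3 - 6 else if t < 3 + 3 * 6 then 1 else 0) →
      (∀ t, R₂.sortedParts.getD t 0 = if t < 3 then 3 * 3 else 0) →
      0 < kroneckerCoeff ℂ mu (Nat.Partition.rectangle (3 * 3) 3) R₂ :=
  stretchedHook_claim_base_of_kronSum (by norm_num) (by norm_num)
    [3, 3, 3, 1, 1, 1, 1, 1, 1, 1, 1, 1, 1, 1, 1, 1, 1, 1, 1, 1, 1] (by decide)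
    (getD_eq_of_forall_lt _ _ 21 (by decide) (fun t ht => by rw [if_neg (by omega), if_neg (by omega)])
      (by decide)) ipsh_kronSum_mu3_33_r6

/-- **From the Claim at `(m, m)` back to the stretched hook** ("Note that
`μ^i[m,m] = (i(m-k, 1^k))ᵗ`, so by transposing one of the rectangles the statement to prove is
equivalent to showing that `g(μ^i[m,m], (im) × m, m × (im)) > 0`"): for `r + k + 1 = m²`, the Claim
at `(i, r, m, m)` gives `g(i(m²-k,1^k), m × im, m × im) > 0` (tree: `kroneckerCoeff_transpose₁₂`,
`g(λ, μ, ν) = g(λᵗ, μᵗ, ν)`; the rows of the transposed shape are its column lengths,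
`getD_sortedParts_transpose`). [cite: IkenmeyerPanova2017, Prop. 5.2 (proof, reduction to the Claim; TeX L1242–1247)] -/
theorem stretchedHook_pos_of_claim {i m r k : ℕ} (hrk : r + k + 1 = m ^ 2)
    (hC : ∀ (mu R₂ : Nat.Partition (i * m * m)),
      (∀ t, mu.sortedParts.getD t 0 = if t < i then m * m - r else if t < i + i * r then 1 else 0) →
      (∀ t, R₂.sortedParts.getD t 0 = if t < m then i * m else 0) →
      0 < kroneckerCoeff ℂ mu (Nat.Partition.rectangle (i * m) m) R₂) :
    ∀ lam : Nat.Partition (m * (i * m)),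
      lam.parts = (i * (m ^ 2 - k)) ::ₘ Multiset.replicate k i →
      0 < kroneckerCoeff ℂ lam (Nat.Partition.rectangle m (i * m)) (Nat.Partition.rectangle m (i * m)) := by
  intro lam hlam
  have hk : k + 1 ≤ m ^ 2 := by omega
  have hrows := stretchedHook_rows hk hlam
  have e1 : m ^ 2 = m * m := sq m
  have e2 : i * (m ^ 2 - k) = i + i * r := by
    rw [show m ^ 2 - k = r + 1 by omega]; ring
  let mu : Nat.Partition (i * m * m) :=
    ⟨lam.transpose.parts, lam.transpose.parts_pos, by rw [lam.transpose.parts_sum]; ring⟩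
  have hmu : ∀ t, mu.sortedParts.getD t 0 =
      if t < i then m * m - r else if t < i + i * r then 1 else 0 := by
    intro t
    rw [sortedParts_congr_parts (show mu.parts = lam.transpose.parts from rfl),
      getD_sortedParts_transpose]
    refine colLen_eq_of_forall lam fun s => ?_
    rw [hrows s, e2]
    split_ifs <;> omega
  let R₂ : Nat.Partition (i * m * m) :=
    ⟨(Nat.Partition.rectangle m (i * m)).parts, (Nat.Partition.rectangle m (i * m)).parts_pos, by
      rw [(Nat.Partition.rectangle m (i * m)).parts_sum]; ring⟩
  have hR₂ : ∀ t, R₂.sortedParts.getD t 0 = if t < m then i * m else 0 := fun t => by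
    rw [sortedParts_congr_parts (show R₂.parts = (Nat.Partition.rectangle m (i * m)).parts from rfl),
      getD_sortedParts_rectangle]
  have h := hC mu R₂ hmu hR₂
  rw [kroneckerCoeff_transpose₁₂ ℂ lam]
  rwa [← kroneckerCoeff_congr_parts (by ring : m * (i * m) = i * m * m) (lam := lam.transpose)
    (mu := (Nat.Partition.rectangle m (i * m)).transpose) (nu := Nat.Partition.rectangle m (i * m))
    (lam' := mu) (mu' := Nat.Partition.rectangle (i * m) m) (nu' := R₂) rfl
    (transpose_rectangle_parts m (i * m)) rfl] at h

end Claim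

/-! ### Prop. 5.2 -/

/-- **Ikenmeyer–Panova 2017, Prop. 5.2 (stretched hooks), PROVED** — discharge of the named fact
`ikenmeyerPanova2017_prop_5_2`: "Let `i > 1`. For any `m ≥ 7` and `k ∈ [0, m² - 1]` we have that
`g(i(m² - k, 1^k), m × (im), m × (mi)) > 0`." The proof is the printed one (TeX L1234–1261): for
`k ∉ {1,2,4,6, m²-7, m²-5, m²-3, m²-2}` the hook positivity (tree `ikenmeyerPanova2017_cor_4_4_square`)
and the semigroup property; `i ≥ 4` reduces to `i ∈ {2, 3}` by `i = (i-2) + 2`; for `k ∈ {1,2,4,6}`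
the base coefficients — in print "finite calculations for `i = 2, 3` and `m = 7`", here smaller frames
certified in the kernel (the tree's `ipcComp_*`) grown to `m × im`; for the four large `k` the
printed Claim by induction on `(a,b)` from the kernel-certified bases `(2,2)` (`𝔖_8`), `(3,3)`
(`𝔖_18`, `𝔖_27`; files `IP17StretchedHookComputations*`) in place of the printed base `(7,7)`.
[cite: IkenmeyerPanova2017, Prop. 5.2 (TeX L1231–1262; held: Proposition 25, chunk p0013)] -/
theorem ikenmeyerPanova2017_prop_5_2_holds : ikenmeyerPanova2017_prop_5_2 := by
  intro i m k hi hm hk lam hlam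
  have hk' : k < m ^ 2 := by omega
  have hm3 : 3 ≤ m := by omega
  have hm2 : 2 ≤ m := by omega
  by_cases hsmall : k = 1 ∨ k = 2 ∨ k = 4 ∨ k = 6
  · have hP2 : ∀ lam : Nat.Partition (m * (2 * m)),
        lam.parts = (2 * (m ^ 2 - k)) ::ₘ Multiset.replicate k 2 →
        0 < kroneckerCoeff ℂ lam (Nat.Partition.rectangle m (2 * m))
          (Nat.Partition.rectangle m (2 * m)) := by
      rcases hsmall with rfl | rfl | rfl | rfl
      exacts [stretchedHook_pos_two_one hm, stretchedHook_pos_two_two hm,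
        stretchedHook_pos_two_four hm, stretchedHook_pos_two_six hm]
    have hP3 : ∀ lam : Nat.Partition (m * (3 * m)),
        lam.parts = (3 * (m ^ 2 - k)) ::ₘ Multiset.replicate k 3 →
        0 < kroneckerCoeff ℂ lam (Nat.Partition.rectangle m (3 * m))
          (Nat.Partition.rectangle m (3 * m)) := by
      rcases hsmall with rfl | rfl | rfl | rfl
      exacts [stretchedHook_pos_three_one hm, stretchedHook_pos_three_two hm,
        stretchedHook_pos_three_four hm, stretchedHook_pos_three_six hm]
    exact stretchedHook_pos_of_two_three hk hP2 hP3 i (by omega) lam hlam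
  by_cases hlarge : k + 7 = m ^ 2 ∨ k + 5 = m ^ 2 ∨ k + 3 = m ^ 2 ∨ k + 2 = m ^ 2
  · -- `r = m² - 1 - k ∈ {6, 4, 2, 1}`: the Claim for `i = 2` and `i = 3`
    have key : ∀ r, r + k + 1 = m ^ 2 → (r = 6 ∨ r = 4 ∨ r = 2 ∨ r = 1) →
        0 < kroneckerCoeff ℂ lam (Nat.Partition.rectangle m (i * m))
          (Nat.Partition.rectangle m (i * m)) := by
      intro r hrk hr
      have hP2 := fun hC => stretchedHook_pos_of_claim (i := 2) hrk hC
      have hP3 := fun hC => stretchedHook_pos_of_claim (i := 3) hrk hC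
      refine stretchedHook_pos_of_two_three hk (hP2 ?_) (hP3 ?_) i (by omega) lam hlam
      · rcases hr with rfl | rfl | rfl | rfl
        · exact stretchedHook_claim_of_base (by norm_num) stretchedHook_claim_base_2_6 m m hm3 hm3
        · exact stretchedHook_claim_of_base (by norm_num) stretchedHook_claim_base_2_4 m m hm3 hm3
        · exact stretchedHook_claim_of_base (by norm_num) stretchedHook_claim_base_2_2 m m hm2 hm2
        · exact stretchedHook_claim_of_base (by norm_num) stretchedHook_claim_base_2_1 m m hm2 hm2
      · rcases hr with rfl | rfl | rfl | rfl
        · exact stretchedHook_claim_of_base (by norm_num) stretchedHook_claim_base_3_6 m m hm3 hm3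
        · exact stretchedHook_claim_of_base (by norm_num) stretchedHook_claim_base_3_4 m m hm3 hm3
        · exact stretchedHook_claim_of_base (by norm_num) stretchedHook_claim_base_3_2 m m hm3 hm3
        · exact stretchedHook_claim_of_base (by norm_num) stretchedHook_claim_base_3_1 m m hm3 hm3
    rcases hlarge with h | h | h | h
    exacts [key 6 (by omega) (by simp), key 4 (by omega) (by simp), key 2 (by omega) (by simp),
      key 1 (by omega) (by simp)]
  · simp only [not_or] at hsmall hlarge
    exact stretchedHook_pos_of_one hk (stretchedHook_pos_one_of_admissible hm hk' hsmall.1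
      hsmall.2.1 hsmall.2.2.1 hsmall.2.2.2 hlarge.2.2.2 hlarge.2.2.1 hlarge.2.1 hlarge.1) i
      (by omega) lam hlam

/-! ### Cor. 5.3 (stretching factor 2): even-rowed bodies

Printed proof: "Cut `ρ` columnwise and group pairs of columns of the same length `k` so that you get
partitions `(k × 2)`. By Prop. 5.2 we have `a_{(k × 2)}(m) > 0`. Using the semigroup property we get
the result." Here the pairs of columns are peeled two at a time (the rows `min(ρ_t, 2)` form the
block `(c × 2)`, `c` = number of rows of `ρ`), the blocks are added with the semigroup property in the
orientation `m × n` (`m` rows), the frame is transposed (`kroneckerCoeff_rectangle_transpose`), and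
the value at the given `n ≥ |ρ|` is reached by Manivel's stability (tree: `kroneckerCoeff_rowLift_eq`,
`kroneckerCoeff_le_kroneckerCoeff_rowLift`) — the printed `a_ρ(m)` being this common value. -/

section Cor53

/-- **Even-rowed bodies, the semigroup assembly**: for `m ≥ 7` and a weakly decreasing row function
`w` with even values and fewer than `m²` nonzero rows, some shape with lower rows `w` is positive
against a frame with `m` rows — by induction on `w 0 / 2`, adding the block `2(m²-c, 1^c)` of Prop. 5.2
(`c` = number of nonzero rows) with the semigroup property.
[cite: IkenmeyerPanova2017, Cor. 5.3 (proof; TeX L1277–1281)] -/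
theorem evenBody_pos_aux (h52 : ikenmeyerPanova2017_prop_5_2) {m : ℕ} (hm : 7 ≤ m) :
    ∀ (J : ℕ) (w : ℕ → ℕ), Antitone w → (∀ t, Even (w t)) → (∀ t, m ^ 2 ≤ t + 1 → w t = 0) →
      w 0 ≤ 2 * J →
      ∃ (n₁ : ℕ) (lam₁ : Nat.Partition (m * n₁)),
        (∀ t, lam₁.sortedParts.getD (t + 1) 0 = w t) ∧
        0 < kroneckerCoeff ℂ lam₁ (Nat.Partition.rectangle m n₁) (Nat.Partition.rectangle m n₁) := by
  intro J
  induction J with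
  | zero =>
    intro w hanti _ _ hw0
    have hw : ∀ t, w t = 0 := fun t => Nat.le_zero.1 ((hanti (Nat.zero_le t)).trans hw0)
    refine ⟨1, Nat.Partition.indiscrete (m * 1), fun t => ?_, kroneckerCoeff_indiscrete_pos ℂ _⟩
    rw [getD_sortedParts_indiscrete, if_neg (Nat.succ_ne_zero t), hw t]
  | succ J ih =>
    intro w hanti heven hsupp hw0
    by_cases hz : w 0 = 0
    · have hw : ∀ t, w t = 0 := fun t => Nat.le_zero.1 ((hanti (Nat.zero_le t)).trans hz.le)
      refine ⟨1, Nat.Partition.indiscrete (m * 1), fun t => ?_, kroneckerCoeff_indiscrete_pos ℂ _⟩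
      rw [getD_sortedParts_indiscrete, if_neg (Nat.succ_ne_zero t), hw t]
    -- the number `c` of nonzero rows
    have hm1 : 1 ≤ m ^ 2 := Nat.one_le_pow _ _ (by omega)
    have hex : ∃ t, w t = 0 := ⟨m ^ 2 - 1, hsupp _ (by omega)⟩
    classical
    set c := Nat.find hex with hc
    have hc_spec : w c = 0 := Nat.find_spec hex
    have hc_le : c ≤ m ^ 2 - 1 := Nat.find_min' hex (hsupp _ (by omega))
    have hzero : ∀ t, c ≤ t → w t = 0 := fun t ht => Nat.le_zero.1 ((hanti ht).trans hc_spec.le)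
    have hne : ∀ t, t < c → w t ≠ 0 := fun t ht => Nat.find_min hex ht
    have htwo : ∀ t, t < c → 2 ≤ w t := by
      intro t ht
      obtain ⟨x, hx⟩ := heven t
      have := hne t ht
      omega
    have hc1 : c + 1 ≤ m ^ 2 := by omega
    -- the peeled row function
    obtain ⟨n', lam', hrows', hpos'⟩ := ih (fun t => w t - 2)
      (fun s t hst => Nat.sub_le_sub_right (hanti hst) 2)
      (fun t => by obtain ⟨x, hx⟩ := heven t; exact ⟨x - 1, by omega⟩)
      (fun t ht => show w t - 2 = 0 by rw [hsupp t ht]) (show w 0 - 2 ≤ 2 * J by omega)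
    -- the block `2(m² - c, 1^c)` against `m × 2m`
    obtain ⟨blk, hblk⟩ := exists_parts_eq_stretchedHook (i := 2) (m := m) (k := c) (by norm_num) hc1
    have hblk_pos := h52 2 m c (by norm_num) hm hc1 blk hblk
    have hS := ikenmeyerPanova2017_semigroup_holds _ _ _ _ _ _ hpos' hblk_pos
    refine ⟨n' + 2 * m, ⟨(lam'.rowAdd blk).parts, (lam'.rowAdd blk).parts_pos, by
      rw [(lam'.rowAdd blk).parts_sum]; ring⟩, fun t => ?_, ?_⟩
    · rw [sortedParts_congr_parts (show (⟨(lam'.rowAdd blk).parts, (lam'.rowAdd blk).parts_pos, _⟩ :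
          Nat.Partition (m * (n' + 2 * m))).parts = (lam'.rowAdd blk).parts from rfl),
        getD_sortedParts_rowAdd, hrows' t, stretchedHook_rows hc1 hblk, if_neg (Nat.succ_ne_zero t)]
      by_cases ht : t < c
      · rw [if_pos (by omega)]
        have := htwo t ht
        omega
      · rw [if_neg (by omega), hzero t (by omega)]
    · rwa [kroneckerCoeff_congr_parts (by ring : m * n' + m * (2 * m) = m * (n' + 2 * m))
        (lam' := (⟨(lam'.rowAdd blk).parts, (lam'.rowAdd blk).parts_pos, _⟩ :
          Nat.Partition (m * (n' + 2 * m)))) rfl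
        (rowAdd_rectangle_parts m n' (2 * m)) (rowAdd_rectangle_parts m n' (2 * m))] at hS

/-- **Same lower rows in two frames `n × m`, `(n+j) × m`: the larger shape is the row lift `λ♯`**
(tree `rowLift`: `j m` boxes added to the first row). [cite: IkenmeyerPanova2017, Thm. 2.1 / List of notations (a_ρ(d) = g(ρ(nd), n × d, n × d), n ≥ |ρ|)] -/
theorem parts_eq_rowLift_of_rows {n m j : ℕ} (lam : Nat.Partition (n * m))
    (lam' : Nat.Partition ((n + j) * m))
    (h : ∀ t, lam'.sortedParts.getD (t + 1) 0 = lam.sortedParts.getD (t + 1) 0) :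
    lam'.parts = (rowLift lam j).parts :=
  parts_eq_of_getD_succ_eq rfl lam' (rowLift lam j) fun t => by
    rw [h t, getD_sortedParts_rowLift, if_neg (Nat.succ_ne_zero t), add_zero]

/-- **Manivel's stability, as used for `a_ρ(d)`**: two shapes with the same body against frames
`n × m` and `n₁ × m`; if the one at `n₁` is positive and `|λ̄| ≤ n`, the one at `n` is positive
(`n ≤ n₁`: the EQUALITY `kroneckerCoeff_rowLift_eq`, IP Thm. 2.1 with `n ≥ |ρ|`; `n₁ ≤ n`: the
monotonicity `kroneckerCoeff_le_kroneckerCoeff_rowLift`).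
[cite: IkenmeyerPanova2017, Thm. 2.1 with Rem. 2.2 and List of notations (a_ρ(d); TeX L500–520, L1523–1534)] -/
theorem pos_of_rows_eq_of_bodySize_le {n n₁ m : ℕ} (lam : Nat.Partition (n * m))
    (lam₁ : Nat.Partition (n₁ * m)) (hbody : bodySize lam ≤ n)
    (h : ∀ t, lam₁.sortedParts.getD (t + 1) 0 = lam.sortedParts.getD (t + 1) 0)
    (hpos : 0 < kroneckerCoeff ℂ lam₁ (Nat.Partition.rectangle n₁ m) (Nat.Partition.rectangle n₁ m)) :
    0 < kroneckerCoeff ℂ lam (Nat.Partition.rectangle n m) (Nat.Partition.rectangle n m) := by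
  rcases le_total n n₁ with hle | hle
  · obtain ⟨j, rfl⟩ := Nat.exists_eq_add_of_le hle
    have hp := parts_eq_rowLift_of_rows lam lam₁ h
    rw [← kroneckerCoeff_rowLift_eq lam hbody j]
    rwa [kroneckerCoeff_congr_parts rfl (lam' := rowLift lam j)
      (mu' := Nat.Partition.rectangle (n + j) m) (nu' := Nat.Partition.rectangle (n + j) m) hp rfl rfl]
      at hpos
  · obtain ⟨j, rfl⟩ := Nat.exists_eq_add_of_le hle
    have hp := parts_eq_rowLift_of_rows lam₁ lam fun t => (h t).symm
    rw [kroneckerCoeff_congr_parts rfl (lam' := rowLift lam₁ j)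
      (mu' := Nat.Partition.rectangle (n₁ + j) m) (nu' := Nat.Partition.rectangle (n₁ + j) m) hp rfl rfl]
    exact lt_of_lt_of_le hpos (kroneckerCoeff_le_kroneckerCoeff_rowLift lam₁ j)

/-- **Cor. 5.3 from Prop. 5.2** (the printed proof, with the stability making `a_ρ(m)` well defined).
[cite: IkenmeyerPanova2017, Cor. 5.3 (TeX L1273–1281; held: Corollary 26, chunk p0014)] -/
theorem ikenmeyerPanova2017_cor_5_3_of_prop_5_2 (h52 : ikenmeyerPanova2017_prop_5_2) :
    ikenmeyerPanova2017_cor_5_3 := by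
  intro m n hm lam hn hℓ heven
  set w : ℕ → ℕ := fun t => lam.sortedParts.getD (t + 1) 0 with hw
  have hanti : Antitone w := fun s t hst => antitone_getD_sortedParts lam (Nat.succ_le_succ hst)
  have hwev : ∀ t, Even (w t) := by
    intro t
    by_cases h0 : w t = 0
    · rw [h0]; exact ⟨0, rfl⟩
    · apply heven
      rw [body_eq_coe_tail, Multiset.mem_coe]
      have h := mem_of_getD_ne_zero (l := lam.sortedParts.tail) (t := t) (by rwa [getD_tail_sortedParts])
      rwa [getD_tail_sortedParts] at h
  have hsupp : ∀ t, m ^ 2 ≤ t + 1 → w t = 0 := by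
    intro t ht
    have hcb := card_body lam
    exact getD_sortedParts_eq_zero lam (by omega)
  obtain ⟨n₁, lam₁, hrows₁, hpos₁⟩ := evenBody_pos_aux h52 hm (w 0) w hanti hwev hsupp (by omega)
  let lam₁' : Nat.Partition (n₁ * m) := ⟨lam₁.parts, lam₁.parts_pos, by rw [lam₁.parts_sum, mul_comm]⟩
  have hpos₁' : 0 < kroneckerCoeff ℂ lam₁' (Nat.Partition.rectangle n₁ m)
      (Nat.Partition.rectangle n₁ m) := by
    rwa [kroneckerCoeff_rectangle_transpose lam₁ lam₁' rfl] at hpos₁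
  exact pos_of_rows_eq_of_bodySize_le lam lam₁' hn
    (fun t => by rw [sortedParts_congr_parts (show lam₁'.parts = lam₁.parts from rfl), hrows₁ t]) hpos₁'

/-- **Ikenmeyer–Panova 2017, Cor. 5.3 (stretching factor 2), PROVED** — discharge of the named fact
`ikenmeyerPanova2017_cor_5_3`: "Fix `m ≥ 7`. Let `ρ` be a partition with `ℓ(ρ) < m²` in which every
row is of even length. Then `a_ρ(m) > 0`." From Prop. 5.2 (`ikenmeyerPanova2017_prop_5_2_holds`) by the
printed proof. [cite: IkenmeyerPanova2017, Cor. 5.3 (TeX L1273–1281; held: Corollary 26, chunk p0014)] -/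
theorem ikenmeyerPanova2017_cor_5_3_holds : ikenmeyerPanova2017_cor_5_3 :=
  ikenmeyerPanova2017_cor_5_3_of_prop_5_2 ikenmeyerPanova2017_prop_5_2_holds

end Cor53

/-! ### Cor. 5.4 (trivial saturation of the rectangular Kronecker semigroup)

Printed proof: "`(k × 3)(3m²) ∈ S_d` and `(k × 2)(2m²) ∈ S_d`. Subtracting these we obtain
`(m²-k, k × 1) ∈ G_d`", then the unit vectors `v_{k+1}`, `ν := ∑ λ_k v_k`, and
"`(d, 0, …, 0) ∈ S_d`". Here the bookkeeping is done column by column: peeling the first column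
(`c` boxes) of `λ` uses `(c × 1)(m²) + (c-1 … )`: precisely the identity of row vectors
`col_c + 2(m²-(c-1), 1^{c-1}) + (m² - c)·e₁ = 3(m²-(c-1), 1^{c-1})`; the multiples of `e₁` are
collected in a number `C`, which at the end is a multiple of `d` by counting boxes and is realised by
the one-row triple `((dq), d × q, d × q)`. -/

section Cor54

/-- **The column-by-column bookkeeping of the printed proof of Cor. 5.4**: for `d ≥ 7` and a weakly
decreasing row function `w` supported on the first `d²` rows there are `μ, ν ∈ S_d` (positive
against frames with `d` rows) and `C ∈ ℕ` with `w + ν + C e₁ = μ` row-wise.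
[cite: IkenmeyerPanova2017, Cor. 5.4 (proof; TeX L1301–1310)] -/
theorem saturation_aux (h52 : ikenmeyerPanova2017_prop_5_2) {d : ℕ} (hd : 7 ≤ d) :
    ∀ (X : ℕ) (w : ℕ → ℕ), Antitone w → (∀ t, d ^ 2 ≤ t → w t = 0) → w 0 ≤ X →
      ∃ (q₁ q₂ C : ℕ) (mu : Nat.Partition (d * q₁)) (nu : Nat.Partition (d * q₂)),
        0 < kroneckerCoeff ℂ mu (Nat.Partition.rectangle d q₁) (Nat.Partition.rectangle d q₁) ∧
        0 < kroneckerCoeff ℂ nu (Nat.Partition.rectangle d q₂) (Nat.Partition.rectangle d q₂) ∧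
        ∀ t, w t + nu.sortedParts.getD t 0 + (if t = 0 then C else 0) = mu.sortedParts.getD t 0 := by
  intro X
  induction X with
  | zero =>
    intro w hanti _ hw0
    have hw : ∀ t, w t = 0 := fun t => Nat.le_zero.1 ((hanti (Nat.zero_le t)).trans hw0)
    refine ⟨0, 0, 0, Nat.Partition.indiscrete (d * 0), Nat.Partition.indiscrete (d * 0),
      kroneckerCoeff_pos_of_eq_zero (by simp) _ _ _, kroneckerCoeff_pos_of_eq_zero (by simp) _ _ _,
      fun t => ?_⟩
    rw [hw t, getD_sortedParts_indiscrete, Nat.mul_zero]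
    split_ifs <;> rfl
  | succ X ih =>
    intro w hanti hsupp hw0
    by_cases hz : w 0 = 0
    · exact ih w hanti hsupp (by omega)
    -- the number `c ≥ 1` of nonzero rows
    have hex : ∃ t, w t = 0 := ⟨d ^ 2, hsupp _ le_rfl⟩
    classical
    set c := Nat.find hex with hc
    have hc_spec : w c = 0 := Nat.find_spec hex
    have hc_le : c ≤ d ^ 2 := Nat.find_min' hex (hsupp _ le_rfl)
    have hzero : ∀ t, c ≤ t → w t = 0 := fun t ht => Nat.le_zero.1 ((hanti ht).trans hc_spec.le)
    have hne : ∀ t, t < c → w t ≠ 0 := fun t ht => Nat.find_min hex ht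
    have hc0 : c ≠ 0 := fun h => hz (by rw [h] at hc_spec; exact hc_spec)
    have hk : (c - 1) + 1 ≤ d ^ 2 := by omega
    -- peel the first column
    obtain ⟨q₁, q₂, C, mu, nu, hmu, hnu, hid⟩ := ih (fun t => w t - 1)
      (fun s t hst => Nat.sub_le_sub_right (hanti hst) 1) (fun t ht => show w t - 1 = 0 by rw [hsupp t ht])
      (show w 0 - 1 ≤ X by omega)
    -- the blocks `3(d²-(c-1), 1^{c-1})` and `2(d²-(c-1), 1^{c-1})`
    obtain ⟨P3, hP3⟩ := exists_parts_eq_stretchedHook (i := 3) (m := d) (k := c - 1) (by norm_num) hk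
    obtain ⟨P2, hP2⟩ := exists_parts_eq_stretchedHook (i := 2) (m := d) (k := c - 1) (by norm_num) hk
    have hP3pos := h52 3 d (c - 1) (by norm_num) hd hk P3 hP3
    have hP2pos := h52 2 d (c - 1) (by norm_num) hd hk P2 hP2
    have hSμ := ikenmeyerPanova2017_semigroup_holds _ _ _ _ _ _ hmu hP3pos
    have hSν := ikenmeyerPanova2017_semigroup_holds _ _ _ _ _ _ hnu hP2pos
    refine ⟨q₁ + 3 * d, q₂ + 2 * d, C + (d ^ 2 - c),
      ⟨(mu.rowAdd P3).parts, (mu.rowAdd P3).parts_pos, by rw [(mu.rowAdd P3).parts_sum]; ring⟩,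
      ⟨(nu.rowAdd P2).parts, (nu.rowAdd P2).parts_pos, by rw [(nu.rowAdd P2).parts_sum]; ring⟩,
      ?_, ?_, fun t => ?_⟩
    · rwa [kroneckerCoeff_congr_parts (by ring : d * q₁ + d * (3 * d) = d * (q₁ + 3 * d))
        (lam' := (⟨(mu.rowAdd P3).parts, (mu.rowAdd P3).parts_pos, _⟩ : Nat.Partition (d * (q₁ + 3 * d))))
        rfl (rowAdd_rectangle_parts d q₁ (3 * d)) (rowAdd_rectangle_parts d q₁ (3 * d))] at hSμ
    · rwa [kroneckerCoeff_congr_parts (by ring : d * q₂ + d * (2 * d) = d * (q₂ + 2 * d))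
        (lam' := (⟨(nu.rowAdd P2).parts, (nu.rowAdd P2).parts_pos, _⟩ : Nat.Partition (d * (q₂ + 2 * d))))
        rfl (rowAdd_rectangle_parts d q₂ (2 * d)) (rowAdd_rectangle_parts d q₂ (2 * d))] at hSν
    · rw [sortedParts_congr_parts (show (⟨(mu.rowAdd P3).parts, (mu.rowAdd P3).parts_pos, _⟩ :
          Nat.Partition (d * (q₁ + 3 * d))).parts = (mu.rowAdd P3).parts from rfl),
        sortedParts_congr_parts (show (⟨(nu.rowAdd P2).parts, (nu.rowAdd P2).parts_pos, _⟩ :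
          Nat.Partition (d * (q₂ + 2 * d))).parts = (nu.rowAdd P2).parts from rfl),
        getD_sortedParts_rowAdd, getD_sortedParts_rowAdd, ← hid t, stretchedHook_rows hk hP3,
        stretchedHook_rows hk hP2]
      have e : d ^ 2 - (c - 1) = d ^ 2 - c + 1 := by omega
      rw [e]
      rcases Nat.lt_trichotomy t 0 with ht | rfl | ht
      · omega
      · have h1 := hne 0 (Nat.pos_of_ne_zero hc0)
        simp only [if_true]
        omega
      · have ht0 : t ≠ 0 := by omega
        simp only [if_neg ht0]
        by_cases htc : t < c
        · have h1 := hne t htc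
          rw [if_pos (by omega), if_pos (by omega)]
          omega
        · rw [if_neg (by omega), if_neg (by omega), hzero t (by omega)]
          omega

/-- **Cor. 5.4 from Prop. 5.2** (the printed proof). [cite: IkenmeyerPanova2017, Cor. 5.4 (TeX L1287–1310; held: Corollary 27, chunk p0014)] -/
theorem ikenmeyerPanova2017_cor_5_4_of_prop_5_2 (h52 : ikenmeyerPanova2017_prop_5_2) :
    ikenmeyerPanova2017_cor_5_4 := by
  intro d hd q lam hℓ
  have hd0 : 0 < d := by omega
  set w : ℕ → ℕ := fun t => lam.sortedParts.getD t 0 with hw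
  have hanti : Antitone w := antitone_getD_sortedParts lam
  have hsupp : ∀ t, d ^ 2 ≤ t → w t = 0 := fun t ht => getD_sortedParts_eq_zero lam (hℓ.trans ht)
  obtain ⟨q₁, q₂, C, mu, nu, hmu, hnu, hid⟩ := saturation_aux h52 hd (w 0) w hanti hsupp le_rfl
  -- counting boxes: `d q + d q₂ + C = d q₁`
  have hsum : d * q + d * q₂ + C = d * q₁ := by
    set T := max (max lam.parts.card nu.parts.card) mu.parts.card + 1 with hT
    have h1 := sum_range_getD_sortedParts_of_le lam (L := T) (by omega)
    have h2 := sum_range_getD_sortedParts_of_le nu (L := T) (by omega)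
    have h3 := sum_range_getD_sortedParts_of_le mu (L := T) (by omega)
    have h4 : ∑ t ∈ Finset.range T, (if t = 0 then C else 0) = C := by
      rw [Finset.sum_ite_eq' (Finset.range T) 0 (fun _ => C), if_pos (Finset.mem_range.2 (by omega))]
    have h5 : ∑ t ∈ Finset.range T, (w t + nu.sortedParts.getD t 0 + if t = 0 then C else 0) =
        ∑ t ∈ Finset.range T, mu.sortedParts.getD t 0 := Finset.sum_congr rfl fun t _ => hid t
    rw [Finset.sum_add_distrib, Finset.sum_add_distrib, h4, h2, h3] at h5
    simp only [hw] at h5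
    rw [h1] at h5
    exact h5
  have hle : q + q₂ ≤ q₁ := by
    have : d * (q + q₂) ≤ d * q₁ := by rw [Nat.mul_add]; omega
    exact Nat.le_of_mul_le_mul_left this hd0
  obtain ⟨q₃, hq₃⟩ := Nat.exists_eq_add_of_le hle
  have hC : C = d * q₃ := by
    have : d * q₁ = d * q + d * q₂ + d * q₃ := by rw [hq₃]; ring
    omega
  -- add the one-row triple `((d q₃), d × q₃, d × q₃)` to `ν`
  let nu' : Nat.Partition (d * (q₂ + q₃)) :=
    ⟨(nu.rowAdd (Nat.Partition.indiscrete (d * q₃))).parts,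
      (nu.rowAdd (Nat.Partition.indiscrete (d * q₃))).parts_pos, by
      rw [(nu.rowAdd (Nat.Partition.indiscrete (d * q₃))).parts_sum]; ring⟩
  have hnu' : 0 < kroneckerCoeff ℂ nu' (Nat.Partition.rectangle d (q₂ + q₃))
      (Nat.Partition.rectangle d (q₂ + q₃)) :=
    kroneckerCoeff_pos_rowAdd_row_holds nu hnu nu' rfl
  refine ⟨q₁, q₂ + q₃, mu, nu', hmu, hnu', parts_eq_of_getD_sortedParts_eq fun t => ?_⟩
  rw [getD_sortedParts_rowAdd, sortedParts_congr_parts (show nu'.parts =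
      (nu.rowAdd (Nat.Partition.indiscrete (d * q₃))).parts from rfl),
    getD_sortedParts_rowAdd_indiscrete, ← hid t, hC]
  simp only [hw]
  split_ifs <;> ring

/-- **Ikenmeyer–Panova 2017, Cor. 5.4 (trivial saturation), PROVED** — discharge of the named fact
`ikenmeyerPanova2017_cor_5_4`: "Let `d ≥ 7`. The group `G_d` contains all partitions `λ` for which `d`
divides `|λ|`." From Prop. 5.2 (`ikenmeyerPanova2017_prop_5_2_holds`) by the printed proof.
[cite: IkenmeyerPanova2017, Cor. 5.4 (TeX L1287–1310; held: Corollary 27, chunk p0014)] -/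
theorem ikenmeyerPanova2017_cor_5_4_holds : ikenmeyerPanova2017_cor_5_4 :=
  ikenmeyerPanova2017_cor_5_4_of_prop_5_2 ikenmeyerPanova2017_prop_5_2_holds

end Cor54

/-! ### Cor. 5.1 (classification of vanishing limit coefficients), reduced to Prop. 6.4

Printed proof: "Given `ρ ∉ 𝔛`, `a_ρ > 0` can be seen by choosing large `d` and `n` and applying
Thm. 1.10" — the tree's `ikenmeyerPanova2017_thm_1_7b_holds` (PROVED), the value at the given frame
being the value at the large frame by Manivel's stability in both directions of the frame
(`kroneckerCoeff_rowLift_eq`, frames transposed by `kroneckerCoeff_rectangle_transpose`); "For `ρ ∈ 𝔛`,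
`a_ρ = 0` is a small finite calculation": for the bodies `(2,1)`, `(3,1)` the stability reduces it to
ONE coefficient each, `g((6,2,1),(3³),(3³))` (`𝔖_9`) and `g((12,3,1),(4⁴),(4⁴))` (`𝔖_16`), which the
verified evaluator shows to vanish in the kernel; the four hooks `(1), (1,1), (1⁴), (1⁶)` are the
vanishing clause of Thm. 6.1 (`d ≥ 7`) or its table (`d ≤ 6`), i.e. Prop. 6.4 — for `(1⁶)` the single
coefficient is in `𝔖_36`, beyond the kernel, so the reduction keeps Prop. 6.4 (the named fact
`ikenmeyerPanova2017_prop_6_4`) as hypothesis: `ikenmeyerPanova2017_cor_5_1_of_prop_6_4`. -/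

section Cor51

/-- `|λ̄|` is the sum of the rows below the first. [cite: IkenmeyerPanova2017, §1.1 (|λ̄| + λ₁ = |λ|)] -/
theorem bodySize_eq_sum_lower_rows {N : ℕ} (lam : Nat.Partition N) {L : ℕ}
    (hL : lam.parts.card ≤ L + 1) :
    bodySize lam = ∑ t ∈ Finset.range L, lam.sortedParts.getD (t + 1) 0 := by
  have h := sum_range_getD_sortedParts_of_le lam (L := L + 1) hL
  rw [Finset.sum_range_succ'] at h
  unfold bodySize
  rw [sup_parts_eq_getD_sortedParts]
  omega

/-- Shapes with the same rows below the first have the same body size. [cite: IkenmeyerPanova2017, §1.1 (the body λ̄)] -/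
theorem bodySize_eq_of_lower_rows_eq {N N' : ℕ} (lam : Nat.Partition N) (lam' : Nat.Partition N')
    (h : ∀ t, lam.sortedParts.getD (t + 1) 0 = lam'.sortedParts.getD (t + 1) 0) :
    bodySize lam = bodySize lam' := by
  rw [bodySize_eq_sum_lower_rows lam (L := max lam.parts.card lam'.parts.card) (by omega),
    bodySize_eq_sum_lower_rows lam' (L := max lam.parts.card lam'.parts.card) (by omega)]
  exact Finset.sum_congr rfl fun t _ => h t

/-- Shapes with the same rows below the first have the same number of parts. [folklore] -/
private theorem card_parts_eq_of_lower_rows_eq {N N' : ℕ} (hN : N ≠ 0) (hN' : N' ≠ 0)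
    (lam : Nat.Partition N) (lam' : Nat.Partition N')
    (h : ∀ t, lam.sortedParts.getD (t + 1) 0 = lam'.sortedParts.getD (t + 1) 0) :
    lam.parts.card = lam'.parts.card := by
  have h0 : 0 < lam.parts.card := by
    rw [Multiset.card_pos]
    intro he
    have := lam.parts_sum
    rw [he, Multiset.sum_zero] at this
    exact hN this.symm
  have h0' : 0 < lam'.parts.card := by
    rw [Multiset.card_pos]
    intro he
    have := lam'.parts_sum
    rw [he, Multiset.sum_zero] at this
    exact hN' this.symm
  have key : ∀ c, lam.parts.card ≤ c + 1 ↔ lam'.parts.card ≤ c + 1 := by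
    intro c
    have h1 := getD_sortedParts_pos_iff lam (c + 1)
    have h2 := getD_sortedParts_pos_iff lam' (c + 1)
    rw [h c] at h1
    constructor
    · intro hc
      by_contra hc'
      exact absurd (h1.1 (h2.2 (by omega))) (by omega)
    · intro hc
      by_contra hc'
      exact absurd (h2.1 (h1.2 (by omega))) (by omega)
  have h3 := (key (lam.parts.card - 1)).1 (by omega)
  have h4 := (key (lam'.parts.card - 1)).2 (by omega)
  omega

/-- Shapes with the same rows below the first have the same body. [cite: IkenmeyerPanova2017, §1.1 (the body λ̄)] -/
theorem body_eq_of_lower_rows_eq {N N' : ℕ} (lam : Nat.Partition N) (lam' : Nat.Partition N')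
    (h : ∀ t, lam.sortedParts.getD (t + 1) 0 = lam'.sortedParts.getD (t + 1) 0) :
    body lam = body lam' := by
  rw [body_eq_coe_tail, body_eq_coe_tail]
  congr 1
  refine list_eq_of_getD_eq _ _ (fun x hx => ?_) (fun x hx => ?_) fun t => ?_
  · exact lam.parts_pos ((Multiset.mem_sort _).1 (List.mem_of_mem_tail hx))
  · exact lam'.parts_pos ((Multiset.mem_sort _).1 (List.mem_of_mem_tail hx))
  · rw [getD_tail_sortedParts, getD_tail_sortedParts, h t]

/-- **`a_ρ(d)`, `a_ρ` are well defined: the frame may grow in both directions** (Manivel's stability,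
IP Thm. 2.1 with Rem. 2.2 — "`a_ρ(d) := g(ρ(nd), n × d, n × d)` for `n ≥ |ρ|`", "`a_ρ := …` for
`n, d ≥ |ρ|`", List of notations): for `|λ̄| ≤ n`, `|λ̄| ≤ d` and a shape `Λ` with the same body
against a larger frame `N × D`, `g(λ, n × d, n × d) = g(Λ, N × D, N × D)` (tree:
`kroneckerCoeff_rowLift_eq` in each direction, the frame transposed by `kroneckerCoeff_rectangle_transpose`).
[cite: IkenmeyerPanova2017, Thm. 2.1 with Rem. 2.2 and List of notations (TeX L500–520, L1523–1534)] -/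
theorem kroneckerCoeff_eq_of_frame_le {n d N D : ℕ} (lam : Nat.Partition (n * d))
    (hn : bodySize lam ≤ n) (hd : bodySize lam ≤ d) (hN : n ≤ N) (hD : d ≤ D)
    (Λ : Nat.Partition (N * D))
    (hΛ : ∀ t, Λ.sortedParts.getD (t + 1) 0 = lam.sortedParts.getD (t + 1) 0) :
    kroneckerCoeff ℂ lam (Nat.Partition.rectangle n d) (Nat.Partition.rectangle n d) =
      kroneckerCoeff ℂ Λ (Nat.Partition.rectangle N D) (Nat.Partition.rectangle N D) := by
  obtain ⟨j, rfl⟩ := Nat.exists_eq_add_of_le hN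
  obtain ⟨j', rfl⟩ := Nat.exists_eq_add_of_le hD
  rw [← kroneckerCoeff_rowLift_eq lam hn j]
  let μ' : Nat.Partition (d * (n + j)) :=
    ⟨(rowLift lam j).parts, (rowLift lam j).parts_pos, by rw [(rowLift lam j).parts_sum, mul_comm]⟩
  rw [kroneckerCoeff_rectangle_transpose (rowLift lam j) μ' rfl]
  have hμ' : ∀ t, μ'.sortedParts.getD (t + 1) 0 = lam.sortedParts.getD (t + 1) 0 := fun t => by
    rw [sortedParts_congr_parts (show μ'.parts = (rowLift lam j).parts from rfl),
      getD_sortedParts_rowLift, if_neg (Nat.succ_ne_zero t), add_zero]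
  have hbμ' : bodySize μ' ≤ d := by rw [bodySize_eq_of_lower_rows_eq μ' lam hμ']; exact hd
  rw [← kroneckerCoeff_rowLift_eq μ' hbμ' j']
  let ν' : Nat.Partition ((n + j) * (d + j')) :=
    ⟨(rowLift μ' j').parts, (rowLift μ' j').parts_pos, by rw [(rowLift μ' j').parts_sum, mul_comm]⟩
  rw [kroneckerCoeff_rectangle_transpose (rowLift μ' j') ν' rfl]
  exact kroneckerCoeff_congr_parts rfl (parts_eq_of_getD_succ_eq rfl ν' Λ fun t => by
    rw [sortedParts_congr_parts (show ν'.parts = (rowLift μ' j').parts from rfl),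
      getD_sortedParts_rowLift, if_neg (Nat.succ_ne_zero t), add_zero, hμ' t, hΛ t]) rfl rfl

/-- A shape with prescribed body against a larger frame exists (lift the first row, transpose the
frame, lift again). [cite: IkenmeyerPanova2017, §2.1 (ρ(nd)) and Thm. 2.1] -/
theorem exists_shape_frame_le {n d : ℕ} (lam : Nat.Partition (n * d)) (j j' : ℕ) :
    ∃ Λ : Nat.Partition ((n + j) * (d + j')),
      ∀ t, Λ.sortedParts.getD (t + 1) 0 = lam.sortedParts.getD (t + 1) 0 := by
  let μ' : Nat.Partition (d * (n + j)) :=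
    ⟨(rowLift lam j).parts, (rowLift lam j).parts_pos, by rw [(rowLift lam j).parts_sum, mul_comm]⟩
  refine ⟨⟨(rowLift μ' j').parts, (rowLift μ' j').parts_pos, by
    rw [(rowLift μ' j').parts_sum, mul_comm]⟩, fun t => ?_⟩
  rw [sortedParts_congr_parts (show (⟨(rowLift μ' j').parts, (rowLift μ' j').parts_pos, _⟩ :
      Nat.Partition ((n + j) * (d + j'))).parts = (rowLift μ' j').parts from rfl),
    getD_sortedParts_rowLift, if_neg (Nat.succ_ne_zero t), add_zero,
    sortedParts_congr_parts (show μ'.parts = (rowLift lam j).parts from rfl),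
    getD_sortedParts_rowLift, if_neg (Nat.succ_ne_zero t), add_zero]

/-- **Cor. 5.1, the direction `ρ ∉ 𝔛 ⇒ a_ρ > 0`, PROVED**: "choosing large `d` and `n` and applying
Thm. 1.10" (tree `ikenmeyerPanova2017_thm_1_7b_holds`), brought back to the given frame by the
stability. Body form: for `|λ̄| ≤ n`, `|λ̄| ≤ d` and `λ̄ ∉ 𝔛`, `g(λ, n × d, n × d) > 0`.
[cite: IkenmeyerPanova2017, Cor. 5.1 (proof, first sentence; TeX L1222–1223)] -/
theorem kroneckerCoeff_pos_of_body_not_mem {n d : ℕ} (lam : Nat.Partition (n * d))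
    (hn : bodySize lam ≤ n) (hd : bodySize lam ≤ d) (hX : body lam ∉ ipExceptionalBodies) :
    0 < kroneckerCoeff ℂ lam (Nat.Partition.rectangle n d) (Nat.Partition.rectangle n d) := by
  by_cases h0 : n * d = 0
  · exact kroneckerCoeff_pos_of_eq_zero h0 _ _ _
  set M := lam.parts.card + bodySize lam + 3 with hM
  obtain ⟨Λ, hΛ⟩ := exists_shape_frame_le lam (3 * M ^ 4 + 1) (3 * M ^ 3 + 1)
  have hcard : Λ.parts.card = lam.parts.card :=
    card_parts_eq_of_lower_rows_eq (Nat.mul_ne_zero (by omega) (by omega)) h0 Λ lam hΛ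
  have hbody : body Λ = body lam := body_eq_of_lower_rows_eq Λ lam hΛ
  have hbs : bodySize Λ = bodySize lam := bodySize_eq_of_lower_rows_eq Λ lam hΛ
  have hpos := ikenmeyerPanova2017_thm_1_7b_holds (n + (3 * M ^ 4 + 1)) (d + (3 * M ^ 3 + 1)) M Λ
    (by rw [hbody]; exact hX) (by omega) (by rw [hcard]; nlinarith)
    (by rw [hbs]; exact le_trans (by omega) (Nat.le_mul_of_pos_right M (by omega)))
    (by omega) (by omega)
  rwa [← kroneckerCoeff_eq_of_frame_le lam hn hd (Nat.le_add_right _ _) (Nat.le_add_right _ _) Λ hΛ]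
    at hpos

/-- **`a_{(2,1)} = 0`, the single coefficient**: `g((6,2,1), (3,3,3), (3,3,3)) = 0` (`𝔖_9`), by the
verified evaluator in the kernel ("a small finite calculation").
[cite: IkenmeyerPanova2017, Cor. 5.1 (proof, second sentence; TeX L1224)] -/
theorem kronSum_body21_square_three : kronSum 9 [6, 2, 1] [3, 3, 3] [3, 3, 3] = 0 := by
  decide +kernel

set_option maxHeartbeats 100000000 in
set_option maxRecDepth 100000 in
/-- **`a_{(3,1)} = 0`, the single coefficient**: `g((12,3,1), (4⁴), (4⁴)) = 0` (`𝔖_16`), by the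
verified evaluator in the kernel ("a small finite calculation").
[cite: IkenmeyerPanova2017, Cor. 5.1 (proof, second sentence; TeX L1224)] -/
theorem kronSum_body31_square_four : kronSum 16 [12, 3, 1] [4, 4, 4, 4] [4, 4, 4, 4] = 0 := by
  decide +kernel

/-- **`a_ρ = 0` for `ρ ∈ {(2,1), (3,1)}` at every frame `n × d` with `n, d ≥ |ρ|`**, from the single
coefficient at the frame `|ρ| × |ρ|` by the stability (`kroneckerCoeff_eq_of_frame_le`) and
`n! · g = kronSum` (`factorial_mul_kroneckerCoeff_eq_kronSum`).
[cite: IkenmeyerPanova2017, Cor. 5.1 (proof; TeX L1222–1224)] -/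
theorem kroneckerCoeff_eq_zero_of_lower_rows {n d s : ℕ} (L : List ℕ) (hLpos : ∀ x ∈ L, 0 < x)
    (hLsorted : L.Pairwise (· ≥ ·)) (hLsum : L.sum = s * s) (hs : s ≠ 0)
    (hLbody : ∑ t ∈ Finset.range L.length, L.getD (t + 1) 0 ≤ s)
    (hzero : kronSum (s * s) L (List.replicate s s) (List.replicate s s) = 0)
    (lam : Nat.Partition (n * d)) (hsn : s ≤ n) (hsd : s ≤ d)
    (hrows : ∀ t, lam.sortedParts.getD (t + 1) 0 = L.getD (t + 1) 0) :
    kroneckerCoeff ℂ lam (Nat.Partition.rectangle n d) (Nat.Partition.rectangle n d) = 0 := by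
  let σ : Nat.Partition (s * s) :=
    ⟨(L : Multiset ℕ), fun hx => hLpos _ (Multiset.mem_coe.1 hx), by rw [Multiset.sum_coe, hLsum]⟩
  have hσ : σ.sortedParts = L := sort_coe_eq_of_pairwise hLsorted
  have hbσ : bodySize σ ≤ s := by
    rw [bodySize_eq_sum_lower_rows σ (L := L.length) (by
      rw [← Nat.Partition.length_sortedParts, hσ]; omega), hσ]
    exact hLbody
  rw [← kroneckerCoeff_eq_of_frame_le σ hbσ hbσ hsn hsd lam fun t => by rw [hrows t, hσ]]
  have h := factorial_mul_kroneckerCoeff_eq_kronSum σ (Nat.Partition.rectangle s s)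
    (Nat.Partition.rectangle s s)
  rw [hσ, sortedParts_rectangle s s hs, hzero] at h
  have h' : (s * s).factorial * kroneckerCoeff ℂ σ (Nat.Partition.rectangle s s)
      (Nat.Partition.rectangle s s) = 0 := by exact_mod_cast h
  rcases Nat.mul_eq_zero.1 h' with h1 | h1
  · exact absurd h1 (Nat.factorial_ne_zero _)
  · exact h1

/-- The rows below the first of a shape whose body sorts to the list `L`.
[cite: IkenmeyerPanova2017, §1.1 (the body λ̄)] -/
theorem lower_rows_of_body_sort {N : ℕ} (lam : Nat.Partition N) {L : List ℕ}
    (hL : (body lam).sort (· ≥ ·) = L) (hL0 : L ≠ []) (t : ℕ) :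
    lam.sortedParts.getD (t + 1) 0 = L.getD t 0 := by
  rw [(sortedParts_eq_cons_of_body lam hL hL0).1, List.getD_cons_succ]

/-- The membership side conditions of the table of Thm. 6.1 for the hook legs `k ∈ {1, 2, 4, 6}`,
`k ≤ d ≤ 6`. [cite: IkenmeyerPanova2017, Thm. 6.1 (table d ≤ 6; TeX L1344–1353)] -/
private theorem table_hyp_of_small {d k : ℕ} (hd : d ≤ 6)
    (hk : k = 1 ∨ k = 2 ∨ k = 4 ∨ k = 6) :
    d ^ 2 ≤ k ∨ (d = 6 ∧ k ∈ ({1, 2, 4, 6, 13, 22, 29, 31, 33, 34} : Finset ℕ)) ∨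
      (d = 5 ∧ k ∈ ({1, 2, 4, 6, 11, 13, 18, 20, 22, 23} : Finset ℕ)) ∨
      (d = 4 ∧ k ∈ ({1, 2, 4, 6, 9, 11, 13, 14} : Finset ℕ)) ∨
      (d = 3 ∧ k ∈ ({1, 2, 4, 6, 7} : Finset ℕ)) ∨ (d = 2 ∧ k ∈ ({1, 2} : Finset ℕ)) := by
  interval_cases d <;> rcases hk with rfl | rfl | rfl | rfl <;> decide

/-- **The hooks of `𝔛`: `g((nd-k, 1^k), n × d, n × d) = 0` for `k ∈ {1, 2, 4, 6}` and `n, d ≥ k`**,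
from Prop. 6.4 through the vanishing clause / table of Thm. 6.1 (`ikenmeyerPanova2017_thm_6_1_zero`,
`ikenmeyerPanova2017_thm_6_1_table`), in the orientation with the shorter side as the number of rows
(`kroneckerCoeff_rectangle_transpose`). [cite: IkenmeyerPanova2017, Cor. 5.1 (proof) with Thm. 6.1 (TeX L1340–1353)] -/
theorem hook_kroneckerCoeff_eq_zero_of_prop_6_4 (h64 : ikenmeyerPanova2017_prop_6_4) {n d k : ℕ}
    (hk : k = 1 ∨ k = 2 ∨ k = 4 ∨ k = 6) (hkn : k ≤ n) (hkd : k ≤ d) (lam : Nat.Partition (n * d))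
    (hlam : lam.parts = (n * d - k) ::ₘ Multiset.replicate k 1) :
    kroneckerCoeff ℂ lam (Nat.Partition.rectangle n d) (Nat.Partition.rectangle n d) = 0 := by
  -- the case `rows ≤ columns`
  have main : ∀ {a b : ℕ}, a ≤ b → k ≤ a → ∀ mu : Nat.Partition (a * b),
      mu.parts = (a * b - k) ::ₘ Multiset.replicate k 1 →
      kroneckerCoeff ℂ mu (Nat.Partition.rectangle a b) (Nat.Partition.rectangle a b) = 0 := by
    intro a b hab hka mu hmu
    by_cases ha : 7 ≤ a
    · exact ikenmeyerPanova2017_thm_6_1_zero h64 ha hab (by omega) mu hmu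
    · exact ikenmeyerPanova2017_thm_6_1_table h64 (by omega) hab (table_hyp_of_small (by omega) hk)
        mu hmu
  rcases le_total n d with hnd | hdn
  · exact main hnd hkn lam hlam
  · let lam' : Nat.Partition (d * n) := ⟨lam.parts, lam.parts_pos, by rw [lam.parts_sum, mul_comm]⟩
    rw [kroneckerCoeff_rectangle_transpose lam lam' rfl]
    exact main hdn hkd lam' (by change lam.parts = _; rw [hlam, mul_comm])

/-- **Ikenmeyer–Panova 2017, Cor. 5.1 from Prop. 6.4** (`a_ρ = 0 ⇔ ρ ∈ 𝔛`): the direction `⇐` for the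
bodies `(2,1)`, `(3,1)` by the kernel (`𝔖_9`, `𝔖_16`) and for the four hooks by Thm. 6.1 from the
named fact `ikenmeyerPanova2017_prop_6_4` (for `(1⁶)` the single coefficient lives in `𝔖_36`); the
direction `⇒` unconditionally (`kroneckerCoeff_pos_of_body_not_mem`, Thm. 1.10 = tree
`ikenmeyerPanova2017_thm_1_7b_holds`). A PROVED reduction of the named fact `ikenmeyerPanova2017_cor_5_1`
to `ikenmeyerPanova2017_prop_6_4`. [cite: IkenmeyerPanova2017, Cor. 5.1 (TeX L1219–1225; held: Corollary 24, chunk p0013)] -/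
theorem ikenmeyerPanova2017_cor_5_1_of_prop_6_4 (h64 : ikenmeyerPanova2017_prop_6_4) :
    ikenmeyerPanova2017_cor_5_1 := by
  intro n d lam hn hd
  constructor
  · intro h0
    by_contra hX
    exact absurd h0 (kroneckerCoeff_pos_of_body_not_mem lam hn hd hX).ne'
  · intro hX
    have hsum := sum_body lam
    have hN : 0 < n * d := by
      rcases Nat.eq_zero_or_pos (n * d) with h0 | h0
      · exfalso
        have hs : bodySize lam = 0 := by unfold bodySize; omega
        rw [hs] at hsum
        have := (sum_pos_and_le_of_mem_ipExceptionalBodies hX).1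
        omega
      · exact h0
    rcases (mem_ipExceptionalBodies_iff _).1 hX with h | h | h | h | h | h
    · -- `(1)`
      have hb : body lam = Multiset.replicate 1 1 := h
      rw [hb, Multiset.sum_replicate, smul_eq_mul, mul_one] at hsum
      exact hook_kroneckerCoeff_eq_zero_of_prop_6_4 h64 (Or.inl rfl) (by omega) (by omega) lam
        (parts_eq_hook_of_body_eq_replicate hN lam hb)
    · rw [h, Multiset.sum_replicate, smul_eq_mul, mul_one] at hsum
      exact hook_kroneckerCoeff_eq_zero_of_prop_6_4 h64 (Or.inr (Or.inl rfl)) (by omega) (by omega)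
        lam (parts_eq_hook_of_body_eq_replicate hN lam h)
    · rw [h, Multiset.sum_replicate, smul_eq_mul, mul_one] at hsum
      exact hook_kroneckerCoeff_eq_zero_of_prop_6_4 h64 (Or.inr (Or.inr (Or.inl rfl))) (by omega)
        (by omega) lam (parts_eq_hook_of_body_eq_replicate hN lam h)
    · rw [h, Multiset.sum_replicate, smul_eq_mul, mul_one] at hsum
      exact hook_kroneckerCoeff_eq_zero_of_prop_6_4 h64 (Or.inr (Or.inr (Or.inr rfl))) (by omega)
        (by omega) lam (parts_eq_hook_of_body_eq_replicate hN lam h)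
    · -- `(2,1)`: the coefficient `g((6,2,1),(3³),(3³)) = 0`
      have hs3 : bodySize lam = 3 := by rw [← hsum, h]; rfl
      have hrows := lower_rows_of_body_sort lam (L := [2, 1])
        (by rw [h]; exact sort_coe_eq_of_pairwise (l := [2, 1]) (by decide)) (by simp)
      exact kroneckerCoeff_eq_zero_of_lower_rows (s := 3) [6, 2, 1] (by decide) (by decide) (by decide)
        (by norm_num) (by decide +kernel) kronSum_body21_square_three lam (by omega) (by omega)
        fun t => by rw [hrows t]; rfl
    · -- `(3,1)`: the coefficient `g((12,3,1),(4⁴),(4⁴)) = 0`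
      have hs4 : bodySize lam = 4 := by rw [← hsum, h]; rfl
      have hrows := lower_rows_of_body_sort lam (L := [3, 1])
        (by rw [h]; exact sort_coe_eq_of_pairwise (l := [3, 1]) (by decide)) (by simp)
      exact kroneckerCoeff_eq_zero_of_lower_rows (s := 4) [12, 3, 1] (by decide) (by decide) (by decide)
        (by norm_num) (by decide +kernel) kronSum_body31_square_four lam (by omega) (by omega)
        fun t => by rw [hrows t]; rfl

end Cor51

/-! ### Cor. 6.3 (fat hooks by column multiplicities), from Prop. 5.2 and Thm. 6.1

The typed fact follows the printed STATEMENT ("`ρ` with `m_i` columns of length `i` … `g(ρ(nd), d × n,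
d × n) > 0` if `m_i ≠ 1` for `i = 1,2,4,6` and `m_i = 0` for `i = d²-7, d²-5, d²-3, d²-2`"): `ρ` is the
row-wise sum over `i` of the blocks `Bᵢ` = "`m_i` columns of length `i`" = `i` rows of length `m_i`,
i.e. the body of the stretched hook `m_i(N - i, 1^i)` (stretching factor `m_i`, leg `i`). A block with
`m_i ≥ 2` is positive against `d × m_i d` by Prop. 5.2 (every leg `i ≤ d² - 1`), a block with `m_i = 1`
is the hook with leg `i`, positive against `d × d` by Thm. 6.1 / Cor. 4.5 exactly when
`i ∉ {1,2,4,6, d²-7, d²-5, d²-3, d²-2}` — the printed hypotheses; "Since `ρ = ∑ᵢ (blocks)`, the statement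
follows by the Kronecker semigroup property", and `n` grows by one-row triples. (The printed proof,
TeX L1367–1373, writes the blocks as `(i^{m_i})` and quotes a `6 × 6` computation for the legs
`1, 2, 4, 6` with three columns; with Prop. 5.2 available for every stretching factor `≥ 2` that
computation is not needed for the statement as printed and typed.) The blocks are peeled from the
longest columns down (`fatHook_pos_aux`, induction on the number of rows of `ρ`). -/

section Cor63

open Literature.Barriers.ValiantsHypothesis (colCount colCount_cons colCount_zero
  getD_sortedParts_eq_colCount_transpose)

/-- Column multiplicities from the column counts: `#{c ∈ S : c > i-1} = #{c ∈ S : c > i} + #{c ∈ S : c = i}`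
(`i ≥ 1`). [cite: FultonYoungTableaux1997, §0 (conjugate partition)] -/
theorem colCount_pred_eq_colCount_add_count (S : Multiset ℕ) {i : ℕ} (hi : 1 ≤ i) :
    colCount S (i - 1) = colCount S i + Multiset.count i S := by
  induction S using Multiset.induction_on with
  | empty => simp [colCount_zero]
  | cons c S ih =>
    rw [colCount_cons, colCount_cons, Multiset.count_cons, ih]
    split_ifs <;> omega

/-- **The column multiplicity `m_i` of `ρ` (number of columns of length `i`, i.e. the multiplicity of
`i` among the parts of `ρᵗ`) is `ρ_i - ρ_{i+1}`** (rows 1-indexed; here 0-indexed rows `i-1`, `i`).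
[cite: FultonYoungTableaux1997, §0 (conjugate partition)] -/
theorem count_transpose_parts_eq {r : ℕ} (ρ : Nat.Partition r) {i : ℕ} (hi : 1 ≤ i) :
    Multiset.count i ρ.transpose.parts = ρ.sortedParts.getD (i - 1) 0 - ρ.sortedParts.getD i 0 := by
  rw [getD_sortedParts_eq_colCount_transpose, getD_sortedParts_eq_colCount_transpose,
    colCount_pred_eq_colCount_add_count _ hi]
  omega

/-- **Peeling the blocks of equal columns** (the semigroup assembly of the printed proof): for
`d ≥ 7` and a weakly decreasing row function `w` (the rows of `ρ`) with at most `c ≤ d² - 1` nonzero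
rows whose column multiplicities `m_i = w(i-1) - w(i)` satisfy the printed conditions, some shape with
lower rows `w` is positive against a frame `d × n₁`. Blocks with `m ≥ 2` columns: Prop. 5.2
(`h52`); single columns: Thm. 6.1 / Cor. 4.5 (tree `ikenmeyerPanova2017_cor_4_4`).
[cite: IkenmeyerPanova2017, Cor. 6.3 (proof; TeX L1367–1374)] -/
theorem fatHook_pos_aux (h52 : ikenmeyerPanova2017_prop_5_2) {d : ℕ} (hd : 7 ≤ d) :
    ∀ (c : ℕ) (w : ℕ → ℕ), Antitone w → (∀ t, c ≤ t → w t = 0) → c + 1 ≤ d ^ 2 →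
      (∀ i, 1 ≤ i → (i = 1 ∨ i = 2 ∨ i = 4 ∨ i = 6) → w (i - 1) - w i ≠ 1) →
      (∀ i, 1 ≤ i → (i + 7 = d ^ 2 ∨ i + 5 = d ^ 2 ∨ i + 3 = d ^ 2 ∨ i + 2 = d ^ 2) →
        w (i - 1) - w i = 0) →
      ∃ (n₁ : ℕ) (lam₁ : Nat.Partition (d * n₁)),
        (∀ t, lam₁.sortedParts.getD (t + 1) 0 = w t) ∧
        0 < kroneckerCoeff ℂ lam₁ (Nat.Partition.rectangle d n₁) (Nat.Partition.rectangle d n₁) := by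
  intro c
  induction c with
  | zero =>
    intro w _ hsupp _ _ _
    refine ⟨1, Nat.Partition.indiscrete (d * 1), fun t => ?_, kroneckerCoeff_indiscrete_pos ℂ _⟩
    rw [getD_sortedParts_indiscrete, if_neg (Nat.succ_ne_zero t), hsupp t (Nat.zero_le t)]
  | succ c ih =>
    intro w hanti hsupp hc h1 h0
    by_cases hz : w c = 0
    · exact ih w hanti (fun t ht => by
        rcases Nat.lt_or_ge t (c + 1) with h | h
        · have : t = c := by omega
          rw [this, hz]
        · exact hsupp t h) (by omega) h1 h0
    -- `m ≥ 1` columns of the maximal length `c + 1`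
    set m := w c with hm
    have hmle : ∀ t, t ≤ c → m ≤ w t := fun t ht => hanti ht
    have hm1 : w c - w (c + 1) = m := by rw [hsupp (c + 1) le_rfl]; omega
    -- the peeled row function
    obtain ⟨n', lam', hrows', hpos'⟩ := ih (fun t => w t - m)
      (fun s t hst => Nat.sub_le_sub_right (hanti hst) m)
      (fun t ht => by
        rcases Nat.lt_or_ge t (c + 1) with h | h
        · have : t = c := by omega
          rw [this]; exact Nat.sub_self _
        · simp only [hsupp t h, Nat.zero_sub])
      (by omega)
      (fun i hi hI => by
        have := h1 i hi hI
        rcases Nat.lt_or_ge i (c + 1) with h | h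
        · have ha := hmle (i - 1) (by omega); have hb := hmle i (by omega); omega
        · rw [hsupp i h]
          rcases Nat.lt_or_ge (i - 1) (c + 1) with h' | h'
          · have : i - 1 = c := by omega
            rw [this]; omega
          · rw [hsupp (i - 1) h']; omega)
      (fun i hi hI => by
        have := h0 i hi hI
        rcases Nat.lt_or_ge i (c + 1) with h | h
        · have ha := hmle (i - 1) (by omega); have hb := hmle i (by omega); omega
        · rw [hsupp i h]
          rcases Nat.lt_or_ge (i - 1) (c + 1) with h' | h'
          · have : i - 1 = c := by omega
            rw [this]; omega
          · rw [hsupp (i - 1) h']; omega)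
    -- the block: `c + 1` rows of length `m`, positive against `d × n_B`
    have hblock : ∃ (nB : ℕ) (blk : Nat.Partition (d * nB)),
        (∀ t, blk.sortedParts.getD (t + 1) 0 = if t ≤ c then m else 0) ∧
        0 < kroneckerCoeff ℂ blk (Nat.Partition.rectangle d nB) (Nat.Partition.rectangle d nB) := by
      by_cases hm2 : 2 ≤ m
      · -- Prop. 5.2, stretching factor `m`, leg `c + 1`
        obtain ⟨blk, hblk⟩ := exists_parts_eq_stretchedHook (i := m) (m := d) (k := c + 1)
          (by omega) (by omega)
        refine ⟨m * d, blk, fun t => ?_, h52 m d (c + 1) hm2 hd (by omega) blk hblk⟩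
        rw [stretchedHook_rows (by omega) hblk, if_neg (Nat.succ_ne_zero t)]
        by_cases ht : t ≤ c
        · rw [if_pos (by omega), if_pos ht]
        · rw [if_neg (by omega), if_neg ht]
      · -- a single column of length `c + 1`: the hook, Thm. 6.1 / Cor. 4.5
        have hm1' : m = 1 := by omega
        have hj : ¬ (c + 1 = 1 ∨ c + 1 = 2 ∨ c + 1 = 4 ∨ c + 1 = 6) := fun hI => by
          have := h1 (c + 1) (by omega) hI
          rw [Nat.add_sub_cancel] at this
          omega
        have hj' : ¬ (c + 1 + 7 = d ^ 2 ∨ c + 1 + 5 = d ^ 2 ∨ c + 1 + 3 = d ^ 2 ∨ c + 1 + 2 = d ^ 2) :=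
          fun hI => by
            have := h0 (c + 1) (by omega) hI
            rw [Nat.add_sub_cancel] at this
            omega
        simp only [not_or] at hj hj'
        have hlt : c + 1 < d * d := by rw [← sq]; omega
        obtain ⟨blk, hblk⟩ := exists_parts_eq_hook (N := d * d) hlt
        refine ⟨d, blk, fun t => ?_, ikenmeyerPanova2017_cor_4_4 hd le_rfl (by omega) hj.1 hj.2.1
          hj.2.2.1 hj.2.2.2 hj'.2.2.2 hj'.2.2.1 hj'.2.1 hj'.1 blk hblk⟩
        rw [getD_sortedParts_of_parts_eq_hook hlt hblk, if_neg (Nat.succ_ne_zero t), hm1']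
        by_cases ht : t ≤ c
        · rw [if_pos (by omega), if_pos ht]
        · rw [if_neg (by omega), if_neg ht]
    obtain ⟨nB, blk, hblkrows, hblkpos⟩ := hblock
    have hS := ikenmeyerPanova2017_semigroup_holds _ _ _ _ _ _ hpos' hblkpos
    refine ⟨n' + nB, ⟨(lam'.rowAdd blk).parts, (lam'.rowAdd blk).parts_pos, by
      rw [(lam'.rowAdd blk).parts_sum]; ring⟩, fun t => ?_, ?_⟩
    · rw [sortedParts_congr_parts (show (⟨(lam'.rowAdd blk).parts, (lam'.rowAdd blk).parts_pos, _⟩ :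
          Nat.Partition (d * (n' + nB))).parts = (lam'.rowAdd blk).parts from rfl),
        getD_sortedParts_rowAdd, hrows' t, hblkrows t]
      by_cases ht : t ≤ c
      · rw [if_pos ht]
        have := hmle t ht
        omega
      · rw [if_neg ht, hsupp t (by omega)]
        omega
    · rwa [kroneckerCoeff_congr_parts (by ring : d * n' + d * nB = d * (n' + nB))
        (lam' := (⟨(lam'.rowAdd blk).parts, (lam'.rowAdd blk).parts_pos, _⟩ :
          Nat.Partition (d * (n' + nB)))) rfl
        (rowAdd_rectangle_parts d n' nB) (rowAdd_rectangle_parts d n' nB)] at hS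

/-- **Cor. 6.3 from Prop. 5.2** (and the tree's PROVED hook positivity Thm. 6.1 / Cor. 4.5).
[cite: IkenmeyerPanova2017, Cor. 6.3 (TeX L1363–1374; held: Corollary 30, chunk p0015)] -/
theorem ikenmeyerPanova2017_cor_6_3_of_prop_5_2 (h52 : ikenmeyerPanova2017_prop_5_2) :
    ikenmeyerPanova2017_cor_6_3 := by
  intro d hd r ρ h1 h0 hlen
  have hd7 : 7 ≤ d := hd
  set w : ℕ → ℕ := fun t => ρ.sortedParts.getD t 0 with hw
  have hanti : Antitone w := antitone_getD_sortedParts ρ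
  set c := ρ.parts.card with hc
  have hsupp : ∀ t, c ≤ t → w t = 0 := fun t ht => getD_sortedParts_eq_zero ρ ht
  -- the longest column has length `c ≤ d² - 1`
  have hcd : c + 1 ≤ d ^ 2 := by
    rcases Nat.eq_zero_or_pos c with h | hcpos
    · rw [h]; exact Nat.one_le_pow _ _ (by omega)
    · have hcol : ρ.transpose.sortedParts.getD 0 0 = c := by
        rw [getD_sortedParts_transpose]
        exact colLen_eq_of_forall ρ fun i => by rw [hc, ← getD_sortedParts_pos_iff]
      have hmem : c ∈ ρ.transpose.parts := by
        rw [← hcol]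
        exact (Multiset.mem_sort _).1
          (mem_of_getD_ne_zero (l := ρ.transpose.sortedParts) (t := 0) (by rw [hcol]; omega))
      exact hlen c hmem
  have hmult : ∀ i, 1 ≤ i → Multiset.count i ρ.transpose.parts = w (i - 1) - w i :=
    fun i hi => count_transpose_parts_eq ρ hi
  obtain ⟨n₁, lam₁, hrows₁, hpos₁⟩ := fatHook_pos_aux h52 hd7 c w hanti hsupp hcd
    (fun i hi hI => by
      rw [← hmult i hi]
      exact h1 i (by rcases hI with rfl | rfl | rfl | rfl <;> simp))
    (fun i hi hI => by rw [← hmult i hi]; exact h0 i hI)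
  refine ⟨n₁, fun n hn lam hbody => ?_⟩
  obtain ⟨j, rfl⟩ := Nat.exists_eq_add_of_le hn
  -- the lower rows of `λ` are the rows of `ρ`
  have hlow : ∀ t, lam.sortedParts.getD (t + 1) 0 = w t := by
    intro t
    show lam.sortedParts.getD (t + 1) 0 = ρ.sortedParts.getD t 0
    by_cases hρ : ρ.sortedParts = []
    · have hcard : ρ.parts.card = 0 := by rw [← Nat.Partition.length_sortedParts, hρ]; rfl
      have hb0 : Multiset.card (body lam) = 0 := by rw [hbody, hcard]
      have hcl := card_body lam
      rw [getD_sortedParts_eq_zero ρ (by omega), getD_sortedParts_eq_zero lam (by omega)]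
    · exact lower_rows_of_body_sort lam (by rw [hbody]; rfl) hρ t
  have hp : lam.parts = (lam₁.rowAdd (Nat.Partition.indiscrete (d * j))).parts :=
    parts_eq_of_getD_succ_eq (by ring) lam _ fun t => by
      rw [getD_sortedParts_rowAdd_indiscrete, if_neg (Nat.succ_ne_zero t), add_zero, hlow t, hrows₁ t]
  exact kroneckerCoeff_pos_rowAdd_row_holds lam₁ hpos₁ lam hp

/-- **Ikenmeyer–Panova 2017, Cor. 6.3, PROVED** — discharge of the named fact
`ikenmeyerPanova2017_cor_6_3` ("Fix `d > 6` and let `ρ` be a partition with `m_i` columns of length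
`i`. Then `g(ρ(nd), d × n, d × n) > 0` if `m_i ≠ 1` for `i = 1, 2, 4, 6` and `m_i = 0` for
`i = d²-7, d²-5, d²-3, d²-2`", typed with the printed proof's implicit "for all sufficiently large `n`"
and "columns shorter than `d²`"), from `ikenmeyerPanova2017_prop_5_2_holds`.
[cite: IkenmeyerPanova2017, Cor. 6.3 (TeX L1363–1374; held: Corollary 30, chunk p0015)] -/
theorem ikenmeyerPanova2017_cor_6_3_holds : ikenmeyerPanova2017_cor_6_3 :=
  ikenmeyerPanova2017_cor_6_3_of_prop_5_2 ikenmeyerPanova2017_prop_5_2_holds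

end Cor63

/-! ### Cor. 6.10 (two columns against `n × d`, `n ≠ d`), reduced to Prop. 6.9

Printed proof (TeX L1490–1491): "By transposing the two row partition and one of the rectangles, the
statement follows directly from Prop. 6.9": `g((2^k, 1^{nd-2k}), n × d, n × d) =
g((nd-k, k), d × n, n × d)` (transposition property `g(λ, μ, ν) = g(λᵗ, μᵗ, ν)`, tree
`kroneckerCoeff_transpose₁₂`), which Prop. 6.9 evaluates for `k ≥ 1` (`(a^b) = (n^d)`, `(c^d) = (d^n)`,
`a = n ≠ c = d`; its divisibility `(n - d) ∣ n` is `(d - n) ∣ d`); the column `k = 0` is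
`g((1^{nd}), R, R) = [Rᵗ = R] = 0` (tree `kroneckerCoeff_column_eq`; `n ≠ d`), and the empty case
`nd = 0` is `1` on both sides. -/

section Cor610

open Literature.Barriers.ValiantsHypothesis (kroneckerCoeff_column_eq kroneckerCoeff_indiscrete_eq)

/-- The rows of the two-column shape `(2^k, 1^{N-2k})`: `2` on the first `k` rows, then `1` on the
next `N - 2k` rows. [cite: IkenmeyerPanova2017, Cor. 6.10 (the shape ρ = (2^k, 1^{nd-2k}); TeX L1487)] -/
theorem twoColumn_rows {N k : ℕ} {lam : Nat.Partition N}
    (hlam : lam.parts = Multiset.replicate k 2 + Multiset.replicate (N - 2 * k) 1) (t : ℕ) :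
    lam.sortedParts.getD t 0 = if t < k then 2 else if t < k + (N - 2 * k) then 1 else 0 := by
  have hs : lam.sortedParts = List.replicate k 2 ++ List.replicate (N - 2 * k) 1 := by
    unfold Nat.Partition.sortedParts
    rw [hlam, ← Multiset.coe_replicate, ← Multiset.coe_replicate, Multiset.coe_add]
    refine sort_coe_eq_of_pairwise (List.pairwise_append.2 ⟨?_, ?_, ?_⟩)
    · exact List.pairwise_replicate.2 (Or.inr le_rfl)
    · exact List.pairwise_replicate.2 (Or.inr le_rfl)
    · intro a ha b hb
      rw [List.eq_of_mem_replicate ha, List.eq_of_mem_replicate hb]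
      decide
  rw [hs, List.getD_eq_getElem?_getD]
  by_cases ht : t < k
  · rw [List.getElem?_append_left (by simpa using ht), List.getElem?_replicate, if_pos ht, if_pos ht]
    rfl
  · rw [List.getElem?_append_right (by simpa using not_lt.1 ht), List.length_replicate,
      List.getElem?_replicate, if_neg ht]
    by_cases ht' : t < k + (N - 2 * k)
    · rw [if_pos (by omega), if_pos ht']; rfl
    · rw [if_neg (by omega), if_neg ht']; rfl

/-- **Cor. 6.10 from Prop. 6.9** (the printed one-line proof, with the degenerate columns `k = 0`
and the empty frame settled directly). [cite: IkenmeyerPanova2017, Cor. 6.10 (TeX L1486–1491; held: Corollary 34, chunk p0017)] -/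
theorem ikenmeyerPanova2017_cor_6_10_of_prop_6_9 (h69 : ikenmeyerPanova2017_prop_6_9) :
    ikenmeyerPanova2017_cor_6_10 := by
  intro n d k hnd hk lam hlam
  have hrows := twoColumn_rows hlam
  -- the empty frame
  rcases Nat.eq_zero_or_pos (n * d) with hN | hN
  · have hk0 : k = 0 := by omega
    have hdvd : ((d : ℤ) - n) ∣ (d : ℤ) := by
      rcases Nat.mul_eq_zero.1 hN with rfl | rfl
      · simp
      · simp
    rw [if_pos ⟨by omega, hdvd⟩]
    have hsub : ∀ mu nu : Nat.Partition (n * d), mu = nu := fun mu nu =>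
      Nat.Partition.ext (by
        have h1 : mu.parts = 0 := Multiset.eq_zero_of_forall_notMem fun x hx => by
          have := Multiset.le_sum_of_mem hx; rw [mu.parts_sum] at this
          have := mu.parts_pos hx; omega
        have h2 : nu.parts = 0 := Multiset.eq_zero_of_forall_notMem fun x hx => by
          have := Multiset.le_sum_of_mem hx; rw [nu.parts_sum] at this
          have := nu.parts_pos hx; omega
        rw [h1, h2])
    rw [hsub lam (Nat.Partition.indiscrete (n * d)), kroneckerCoeff_indiscrete_eq, if_pos rfl]
  have hn : n ≠ 0 := fun h => by rw [h, Nat.zero_mul] at hN; exact lt_irrefl 0 hN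
  have hd : d ≠ 0 := fun h => by rw [h, Nat.mul_zero] at hN; exact lt_irrefl 0 hN
  rcases Nat.eq_zero_or_pos k with rfl | hkpos
  · -- a single column `(1^{nd})`: `g = [Rᵗ = R] = 0` as `n ≠ d`
    rw [if_neg (fun h => by omega)]
    have hcol : lam.parts = (Nat.Partition.column (n * d)).parts := by
      rw [hlam, Nat.Partition.column_parts, Multiset.replicate_zero, zero_add, Nat.mul_zero,
        Nat.sub_zero]
    rw [kroneckerCoeff_congr_parts rfl (lam' := Nat.Partition.column (n * d))
      (mu' := Nat.Partition.rectangle n d) (nu' := Nat.Partition.rectangle n d) hcol rfl rfl,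
      kroneckerCoeff_column_eq, if_neg]
    intro h
    have hc := congrArg (fun μ : Nat.Partition (n * d) => Multiset.card μ.parts) h
    simp only [transpose_rectangle_parts, rectangle_parts d n hn, rectangle_parts n d hd,
      Multiset.card_replicate] at hc
    exact hnd hc.symm
  -- `k ≥ 1`: transpose the two-column shape and one rectangle, then Prop. 6.9
  rw [kroneckerCoeff_transpose₁₂ ℂ lam, kroneckerCoeff_comm₁₂_holds ℂ, kroneckerCoeff_comm₂₃_holds ℂ]
  -- `g(Rᵗ, R, λᵗ)` with `Rᵗ = (n^d)`, `R = (d^n)`, `λᵗ = (nd - k, k)`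
  have hRt : (Nat.Partition.rectangle n d).transpose.parts = Multiset.replicate d n := by
    rw [transpose_rectangle_parts, rectangle_parts d n hn]
  have hR : (Nat.Partition.rectangle n d).parts = Multiset.replicate n d := rectangle_parts n d hd
  have hlt : lam.transpose.parts = {n * d - k, k} := by
    obtain ⟨nu, hnu⟩ : ∃ nu : Nat.Partition (n * d), nu.parts = {n * d - k, k} :=
      ⟨⟨(([n * d - k, k] : List ℕ) : Multiset ℕ), fun {x} hx => by
          have hx' := Multiset.mem_coe.1 hx
          simp only [List.mem_cons, List.not_mem_nil, or_false] at hx'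
          rcases hx' with rfl | rfl <;> omega,
        by rw [Multiset.sum_coe]; simp only [List.sum_cons, List.sum_nil]; omega⟩, rfl⟩
    have hnus : nu.sortedParts = [n * d - k, k] := by
      unfold Nat.Partition.sortedParts
      rw [hnu, show ({n * d - k, k} : Multiset ℕ) = (([n * d - k, k] : List ℕ) : Multiset ℕ) from rfl]
      exact sort_coe_eq_of_pairwise (by simp; omega)
    rw [← hnu]
    refine parts_eq_of_getD_sortedParts_eq fun i => ?_
    rw [getD_sortedParts_transpose, hnus]
    refine colLen_eq_of_forall lam fun s => ?_
    rw [hrows s]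
    rcases i with _ | _ | i
    · simp only [List.getD_cons_zero]; split_ifs <;> omega
    · simp only [List.getD_cons_succ, List.getD_cons_zero]; split_ifs <;> omega
    · simp only [List.getD_cons_succ, List.getD_nil]; split_ifs <;> omega
  have h := h69 (n * d) n d d n k rfl (by ring) hnd hkpos hk (Nat.Partition.rectangle n d).transpose
    (Nat.Partition.rectangle n d) lam.transpose hRt hR hlt
  by_cases h2 : 2 * k = n * d
  · rw [h.2 h2]
    have hiff : ((n : ℤ) - d) ∣ (n : ℤ) ↔ ((d : ℤ) - n) ∣ (d : ℤ) := by
      have e1 : ((d : ℤ) - n) = -((n : ℤ) - d) := by ring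
      rw [e1, neg_dvd]
      constructor
      · intro h
        have h2 := dvd_sub h (dvd_refl ((n : ℤ) - d))
        rwa [show (n : ℤ) - ((n : ℤ) - d) = d by ring] at h2
      · intro h
        have h2 := dvd_add h (dvd_refl ((n : ℤ) - d))
        rwa [show (d : ℤ) + ((n : ℤ) - d) = n by ring] at h2
    by_cases hdv : ((d : ℤ) - n) ∣ (d : ℤ)
    · rw [if_pos (hiff.2 hdv), if_pos ⟨h2, hdv⟩]
    · rw [if_neg (fun h' => hdv (hiff.1 h')), if_neg (fun h' => hdv h'.2)]
  · rw [h.1 h2, if_neg (fun h' => h2 h'.1)]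

end Cor610


end Literature.Computability.AlgebraicComplexity

end
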